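import Literature.MathematicalPhysics.QuantumFieldTheory.Balaban1983to89.B3Eq119TotalVertexFamily
import Literature.MathematicalPhysics.QuantumFieldTheory.Balaban1983to89.B3GaussianPerturbationGraphs

/-!
# `Balaban1983to89.B3Eq119ChargeOrders` — T. Bałaban, *(Higgs)₂,₃ quantum fields in a finite volume. III.
# Renormalization*, Commun. Math. Phys. **88** (1983) 411–445 [Balaban1983Higgs3], (1.19)–(1.23) pp. 416–417: THE CHARGE
# ORDERS OF THE PERTURBATIVE COEFFICIENTS OF (1.19) — every vertex-number coefficient of the total-vertex family is the sum,
# over the assignments of print's vertex TYPES (1.6), (1.7), (1.8)_{j,0}, (1.10)_{j,0} (`1 ≤ j ≤ n̄`) to the vertices, of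
# `e^{Σ j}` times a CHARGE-FREE truncated Gaussian expectation, plus the assignments using an R-vertex, which are `O(e^{n̄+1})`

statement-level skeleton of published theorems with citation tags; proofs where landed; nothing here is a claim about
the Yang–Mills mass gap

CITATION HEADER (lean-in-tree rule).  Part of the lit-balaban TYPED SKELETON (HOME `run/shared/lean/pub/lit-balaban/`),
Phase 2, proof seat p33 (gen 72, unit `lit-balaban-p33`); row **B3.Eq1.19-1.22** of `HOME/lit-balaban-r15/ROWS-B3.md` (fold
owner r15; head `proved` under the lead's HEAD WORD Q25 — this file is an OPTIONAL located member of the (1.19)/(1.21) cell,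
zero head weight: the sequel of BRICK 6 `B3Eq119TotalVertexFamily` (the `e > 0` total-vertex family) of the target
`B3TwoPointPerturbativeExpansion`).  REUSED BY NAME, nothing re-declared and nothing of another seat modified: BRICK 4's
abstract `TiltData` / `tiltMoment` / `tiltZ` / `tiltExpect` / `pinnedMoments` / `TiltData.pinnedMoments_eq` /
`TiltData.iteratedDerivWithin_tiltExpect_eq_ursellOf_fin` (`B3TwoPointPerturbativeCoefficients`), BRICK 4's (1.19) side
`freeMeasure`, `freeMeasure_neZero`, `abs_twoPointObs_le` (`B3Eq119VertexExpansion`), BRICK 5's `present`, `prod_present_eq`,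
`ursellOf_prod_mul` (`B3GaussianPerturbationGraphs`), BRICK 6's `totalVertex`, `totalFamily`, `tiltData_free_totalVertex`,
`neg_totalVertex_eq_vertices`, `twoPoint_totalVertex_expansion` (`B3Eq119TotalVertexFamily`), p13's combinatorics of record
`UrsellColourings.ursellOf_piFinset` (multilinearity of truncation in the clusters), `UrsellExplicitFormula.ursellOf_eq_sum_setPartitions`
(Ruelle's Möbius form), the typer's ANALYTIC VERTICES `B3Eq18VertexExpansion.vertex16 … vertex111` ((1.6)–(1.11) p. 413,
`leg18`, `leg110`, `remTensor`, `leg110_qpow_of_odd`) and the typer's tensor bounds `B3VertexTensorBounds.norm_q_pow_le_one`,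
`norm_qpow_mul_remOp_le_one` (`‖q‖ ≤ 1`, `‖q^m R_{n̄+1}(·)‖ ≤ 1/(n̄+1)!`).

THE PRINT (p. 416 = PDF 6 of the held text `paper:balaban1983-higgs-2-3-quantum-fields-finite-volume`, L11–24, and p. 417 =
PDF 7, L1–12, re-read this session): «The function G^ε has a perturbative expansion of the following structure
G^ε = Σ_{n=0}^∞ C^ε_0[(−δm² + Σ^ε + …)C^ε_0]ⁿ (1.21) where C^ε_0 = (−Δ^ε_0 + m²)^{−1} and Σ^ε, Σ^ε_1, Σ^ε_2 are given by amputated,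
one-particle-irreducible graphs of the expansion of G^ε. Here we have a graphical description of the same type as in (1.17), but
with some simplifications. We have η = ε (hence L^kε = 1) and the only vertices are (1.6), (1.7) [with δm² instead of δm_i²(x)],
(1.8), and (1.10) with n′ = 0, B̃ = 0, g_k = 1 (but without any restrictions on n). The propagators are C^ε_0 for the scalar
field and C^ε = (−Δ^ε + μ₀²)^{−1} for the vector field … Let us write a few terms of the expansion of Σ^ε: Σ^ε(x − x′) =
−4(N+2)λC^ε_0(0)δ_ε(x − x′) + e²dC^ε(0)q²δ_ε(x − x′) + … (1.22)»; p. 417: «This equation can be solved recursively if δm² and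
Σ^ε are expanded into power series in e, λ … we write δm² = Σ_{2≤α+2β≤4} e^α λ^β δm²_{(α,β)} and we insert this into Σ^ε».
p. 413 (PDF 3): the vertices (1.8)_{n,n′}, (1.10)_{n,n′} carry the explicit factor `(e(L^kε))^{n+n′}`, the R-vertices
(1.9)/(1.11) the factor `(e(L^kε))^{n+n̄+1}`.

THE ARGUMENT (ours — print's sentence is formal perturbation theory in `e`, `λ`).  BRICK 6 expanded (1.19) in the NUMBER of
total vertices `𝒱(e)`; its dictionary `neg_totalVertex_eq_vertices` writes `−𝒱(e) = Σ_{c ∈ κ} X_c` over the finite set of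
VERTEX TYPES `κ = {(1.6), (1.7), R} ⊔ {(1.8)_{j,0} : 1 ≤ j ≤ n̄} ⊔ {(1.10)_{j,0} : 1 ≤ j ≤ n̄}` (`VType n̄`; the odd (1.10)_{j,0}
vanish identically, `vertex110_odd`).  §2 (abstract, any measure space): the pinned tilted moments at `t = 0` of a tilt by
`V = −Σ_c X_c` are, block by block, COLOUR SUMS `⟨[F]Π_{j∈K} Σ_c X_c⟩ = Σ_z ⟨[F]Π_{j∈K} X_{z_j}⟩` (`prod_univ_sum`), so by the
multilinearity of truncation in the clusters (`ursellOf_piFinset`) the `n`-th coefficient is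
`Σ_{z ∈ κⁿ} ⟨F; X_{z_1}; …; X_{z_n}⟩ᵀ` (`iteratedDerivWithin_tiltExpect_zero_eq_sum`); rescaling the types `X_c = a_c X′_c`
rescales the truncated coefficient of `z` by `Π_j a_{z_j}` (`ursellOf_prod_mul`); and if `|X_c| ≤ X̂_c` for all types and
`|X_c| ≤ ρX̂_c` for the types outside a set `G`, a colouring using a type outside `G` has `|⟨F; X_{z_1}; …⟩ᵀ| ≤ ρ·Σ_π (|π|−1)!
Π_{K∈π} ⟨[|F|]Π_{j∈K} X̂_{z_j}⟩` (Möbius form `ursellOf_eq_sum_setPartitions`; in each term exactly the block containing that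
vertex carries `ρ`).  §1/§3 (the (1.19) instance): the GENUINE types are homogeneous in the charge, `X_c(e) = e^{ord c}X_c(1)`
(`ord` = 0, 0, j, j; `vtx_eq_pow_mul_chargeOne`, (1.8)_{j,0} at `B̃ = 0` having the charge-free leg `∂^ηφ`), the R-colour
obeys `|X_R(e)| ≤ |e|^{n̄+1}(R̂₉ + R̂₁₁)` with CHARGE-FREE majorants (`‖q^m R_{n̄+1}‖ ≤ 1/(n̄+1)!`, the typer), all types and
majorants have polynomial growth `≤ K·R(A,φ)^{n̄+3}` in the size `R = 1 + Σ_b ε^d A_b² + Σ_x ε^d|φ(x)|⁴` and are therefore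
integrable, with the observable, against the `e = 0` massive Gaussian of BOTH fields (§0: `R ≤ K_t e^{tQ_A}e^{tQ}`, the action
at `λ = 0` dominating `½μ₀²Q_A + ½m²Q`).  HENCE (§3): the `n`-th coefficient of (1.19) is
`Σ_{z genuine} e^{Σ_j ord z_j}·U_z + Σ_{z ∌ genuine only} X_z(e)`, `U_z = X_z(1)` charge-free (`coefX_chargeOne_eq`), `|X_z(e)| ≤
|e|^{n̄+1}R_z` for `|e| ≤ 1` with `R_z ≥ 0` charge-free (`coefR_eq`) — a polynomial in `e` of degree `≤ n·n̄` plus `O(e^{n̄+1})`,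
for EVERY `n̄` («without any restrictions on n»), `δm²` held at its value (print then expands `δm²` itself, (1.23)).

WHAT IS PROVED (sorry-free; k-general lattice `T^{(k)}` for §0–§3's generic part, the model at `k = 0`):
* §0 `size`, `size_le_exp`, **`integrable_mul_exp_of_le_size_pow`** / `integrable_freeMeasure_of_le_size_pow` — continuous
  observables of polynomial growth in BOTH fields are integrable against `exp(−S^ε_{C,(m²,0,μ₀²,E)})dAdφ` (`m², μ₀² > 0`).
* §1 `VType`, `ord`, `Genuine`, **`vtx`** (the types as functions of `(A,φ)`, typer's `vertex16 … vertex111`),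
  **`neg_totalVertex_eq_sum_vtx`** (`−𝒱(e) = Σ_c X_c`), **`vtx_eq_pow_mul_chargeOne`** (charge homogeneity),
  `abs_vertex19_le` / `abs_vertex111_le` (`|R-vertices| ≤ |e|^{n̄+1}R̂`), `abs_vtx_le`, `rhat_le` (polynomial growth),
  `continuous_vtx`.
* §2 `vfamily`, **`colourMoment`**, `pinnedMoments_zero_eq_sum`, **`iteratedDerivWithin_tiltExpect_zero_eq_sum`** (THE COLOURING
  EXPANSION, abstract), **`ursellOf_colourMoment_smul`** (homogeneity), `hatMoment`, `remBound`,
  **`abs_ursellOf_colourMoment_le`** (a colouring using a small type is small).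
* §3 `xhat`, `abs_vtx_le_xhat`, `abs_vtx_le_pow_mul_xhat`, `integrable_colourProduct`, `integrable_hatProduct`, **`coefX`**,
  **`coefR`**, `coefX_chargeOne_eq` / `coefR_eq` (charge-freeness), **`iteratedDerivWithin_tiltExpect_zero_eq_sum_coefX`**,
  **`coefX_eq_pow_mul`**, **`abs_coefX_le`**; the model: **`iteratedDerivWithin_totalFamily_zero_eq`**,
  **`abs_coefX_model_le`**, **`twoPoint_charge_order_expansion`** (the headline).

HONEST SCOPE.  (i) The coefficients `U_z` are truncated expectations of POLYNOMIALS in `(A, φ)` w.r.t. the `e = 0` Gaussian of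
both fields; their reduction to sums over connected GRAPHS with propagators `C^ε_0` (scalar lines) and `C^ε` (vector lines) is
BRICK 5's engine `B3GaussianPerturbationGraphs.ursellOf_pmoment` once the joint `(A, φ)` Gaussian is presented as p13's `gexp`
— not done here ((1.8)_{j,0} has `j + 2` legs: `∂φ`, `q^jφ`, `A_b^j`).  (ii) `δm²` is held at its value `δm²(ε, e, λ)`; print's
further expansion `δm² = Σ e^αλ^β δm²_{(α,β)}` ((1.23), the definition of the counterterms) and the amputation / 1PI
resummation (1.21) defining `Σ^ε` are not formalized (row B3.Eq1.23-1.25 is a separate, typed row).  (iii) The `O(e^{n̄+1})`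
bound is stated for `|e| ≤ 1` with an explicit charge-free majorant, not uniformly in `ε` (no claim about `ε → 0`).
-/

open Finset MeasureTheory Filter Topology
open scoped ContDiff NNReal InnerProductSpace BigOperators
open Literature.Probability.LatticeModels (ursellOf setPartitions mem_setPartitions IsSetPartition colours
  mem_piFinset_colours ursellOf_piFinset ursellOf_eq_sum_setPartitions)
open Literature.MathematicalPhysics.QuantumFieldTheory.Balaban1983to89.B3TwoPointPerturbativeCoefficients
open Literature.MathematicalPhysics.QuantumFieldTheory.Balaban1983to89.B3Eq119VertexExpansion
open Literature.MathematicalPhysics.QuantumFieldTheory.Balaban1983to89.B3Eq119TotalVertexFamily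

namespace Literature.MathematicalPhysics.QuantumFieldTheory.Balaban1983to89.B3Eq119ChargeOrders

/-! ## §0 Integrability against the `e = 0` Gaussian of observables with polynomial growth in BOTH fields -/

section Integrability

open Set
open HiggsLattice HiggsActionIntegrable B1Sect1Statements
open B1Eq113OneSidedDerivatives (quartic quartic_nonneg continuous_quartic action_lam_zero_ge)

variable {P : HiggsLattice.Params} {k N : ℕ}

/-- `Q_A(A) = Σ_b η^d A_b²` — the mass-term shape of the vector field. [cite: Balaban1982Higgs1, (1.11) p.605] -/
noncomputable def sqVec (P : HiggsLattice.Params) (k : ℕ) (A : HiggsLattice.VecField P k) : ℝ :=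
  ∑ b : HiggsLattice.PBond P k, P.mesh k ^ P.d * A b ^ 2

/-- `Q_A ≥ 0`. [cite: Balaban1982Higgs1, (1.11) p.605] -/
theorem sqVec_nonneg (A : HiggsLattice.VecField P k) : 0 ≤ sqVec P k A :=
  Finset.sum_nonneg fun _ _ => mul_nonneg (pow_nonneg (P.mesh_pos k).le _) (sq_nonneg _)

/-- The SIZE `R(A,φ) = 1 + Σ_b η^d A_b² + Σ_x η^d|φ(x)|⁴` measuring polynomial growth in both fields. [folklore]
[cite: Balaban1983Higgs3, (1.19) p.416] -/
noncomputable def size (Φ : Cfg P k N) : ℝ := 1 + sqVec P k Φ.1 + quartic P k Φ.2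

/-- `R ≥ 1`. [folklore] [cite: Balaban1983Higgs3, (1.19) p.416] -/
theorem one_le_size (Φ : Cfg P k N) : 1 ≤ size Φ := by
  unfold size
  have := sqVec_nonneg (P := P) (k := k) Φ.1
  have := quartic_nonneg (P := P) (k := k) Φ.2
  linarith

/-- `R > 0`. [folklore] [cite: Balaban1983Higgs3, (1.19) p.416] -/
theorem size_pos (Φ : Cfg P k N) : 0 < size Φ := lt_of_lt_of_le one_pos (one_le_size Φ)

/-- The size is continuous. [folklore] [cite: Balaban1983Higgs3, (1.19) p.416] -/
theorem continuous_size : Continuous fun Φ : Cfg P k N => size Φ := by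
  unfold size sqVec
  refine (continuous_const.add ?_).add (continuous_quartic.comp continuous_snd)
  exact continuous_finsetSum _ fun b _ => (((continuous_apply b).comp continuous_fst).pow 2).const_mul _

/-- The Gaussian `exp(−b|v|²)`, `b > 0`, is integrable on `ℝ^N`. [folklore] -/
private theorem integrable_exp_neg_mul_sq_norm' {b : ℝ} (hb : 0 < b) :
    Integrable fun v : EuclideanSpace ℝ (Fin N) => Real.exp (-b * ‖v‖ ^ 2) := by
  refine Integrable.of_integral_ne_zero ?_
  rw [GaussianFourier.integral_rexp_neg_mul_sq_norm hb]
  exact (Real.rpow_pos_of_pos (div_pos Real.pi_pos hb) _).ne'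

/-- A product Gaussian `Π_b exp(−a A_b²) · Π_x exp(−c|φ(x)|²)`, `a, c > 0`, is integrable for `dA dφ`. [folklore] -/
private theorem integrable_gauss {a c : ℝ} (ha : 0 < a) (hc : 0 < c) :
    Integrable fun Φ : Cfg P k N =>
      (∏ bd : HiggsLattice.PBond P k, Real.exp (-a * (Φ.1 bd) ^ 2))
        * ∏ x : HiggsLattice.Site P k, Real.exp (-c * ‖Φ.2 x‖ ^ 2) := by
  have hA : Integrable fun A : HiggsLattice.VecField P k =>
      ∏ bd : HiggsLattice.PBond P k, Real.exp (-a * (A bd) ^ 2) :=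
    Integrable.fintype_prod (f := fun (_ : HiggsLattice.PBond P k) (t : ℝ) => Real.exp (-a * t ^ 2))
      fun _ => integrable_exp_neg_mul_sq ha
  have hφ : Integrable fun φ : HiggsLattice.ScalarField P k N =>
      ∏ x : HiggsLattice.Site P k, Real.exp (-c * ‖φ x‖ ^ 2) :=
    Integrable.fintype_prod (f := fun (_ : HiggsLattice.Site P k) (v : EuclideanSpace ℝ (Fin N)) =>
      Real.exp (-c * ‖v‖ ^ 2)) fun _ => integrable_exp_neg_mul_sq_norm' hc
  have h := hA.mul_prod hφ
  rw [← Measure.volume_eq_prod] at h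
  exact h

/-- `x ≤ t⁻¹ e^{tx}` for `t > 0`. [folklore] -/
private theorem le_inv_mul_exp {t : ℝ} (ht : 0 < t) (x : ℝ) : x ≤ t⁻¹ * Real.exp (t * x) := by
  have h := Real.add_one_le_exp (t * x)
  rw [le_inv_mul_iff₀ ht]
  linarith

/-- `V₄(φ) ≤ |T|·(2/(t²η^d))·e^{tΣ_xη^d|φ(x)|²}` for `t > 0` (polynomial ≤ exponential, sitewise). [folklore] -/
private theorem quartic_le_exp {t : ℝ} (ht : 0 < t) (φ : HiggsLattice.ScalarField P k N) :
    quartic P k φ ≤ Fintype.card (HiggsLattice.Site P k) * (2 / (t ^ 2 * P.mesh k ^ P.d))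
      * Real.exp (t * sqMass P k φ) := by
  have hη : 0 < P.mesh k ^ P.d := pow_pos (P.mesh_pos k) _
  set S : ℝ := sqMass P k φ with hS
  have hsite : ∀ x : HiggsLattice.Site P k,
      P.mesh k ^ P.d * ‖φ x‖ ^ 4 ≤ 2 / (t ^ 2 * P.mesh k ^ P.d) * Real.exp (t * S) := by
    intro x
    set s : ℝ := P.mesh k ^ P.d * ‖φ x‖ ^ 2 with hs
    have hs0 : 0 ≤ s := mul_nonneg hη.le (sq_nonneg _)
    have hsS : s ≤ S := Finset.single_le_sum (f := fun y => P.mesh k ^ P.d * ‖φ y‖ ^ 2)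
      (fun y _ => mul_nonneg hη.le (sq_nonneg _)) (Finset.mem_univ x)
    have h1 : (t * s) ^ 2 / 2 ≤ Real.exp (t * s) := by
      have := Real.pow_div_factorial_le_exp (t * s) (by positivity) 2
      simpa [Nat.factorial] using this
    have h2 : Real.exp (t * s) ≤ Real.exp (t * S) := Real.exp_le_exp.2 (by nlinarith)
    have h3 : P.mesh k ^ P.d * ‖φ x‖ ^ 4 = s ^ 2 / P.mesh k ^ P.d := by
      rw [hs, eq_div_iff hη.ne']; ring
    rw [h3, div_le_iff₀ hη]
    have h4 : s ^ 2 ≤ 2 / t ^ 2 * Real.exp (t * s) := by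
      rw [div_mul_eq_mul_div, le_div_iff₀ (by positivity)]
      nlinarith
    calc s ^ 2 ≤ 2 / t ^ 2 * Real.exp (t * s) := h4
      _ ≤ 2 / t ^ 2 * Real.exp (t * S) := mul_le_mul_of_nonneg_left h2 (by positivity)
      _ = 2 / (t ^ 2 * P.mesh k ^ P.d) * Real.exp (t * S) * P.mesh k ^ P.d := by
        field_simp
  calc quartic P k φ = ∑ x : HiggsLattice.Site P k, P.mesh k ^ P.d * ‖φ x‖ ^ 4 := rfl
    _ ≤ ∑ _x : HiggsLattice.Site P k, 2 / (t ^ 2 * P.mesh k ^ P.d) * Real.exp (t * S) :=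
        Finset.sum_le_sum fun x _ => hsite x
    _ = Fintype.card (HiggsLattice.Site P k) * (2 / (t ^ 2 * P.mesh k ^ P.d)) * Real.exp (t * S) := by
        rw [Finset.sum_const, Finset.card_univ, nsmul_eq_mul]; ring

/-- The constant `K_t = 1 + t⁻¹ + |T|·2/(t²η^d)` of the bound `R ≤ K_t e^{tQ_A} e^{tQ}`. [folklore] -/
noncomputable def sizeExpConst (P : HiggsLattice.Params) (k : ℕ) (t : ℝ) : ℝ :=
  1 + t⁻¹ + Fintype.card (HiggsLattice.Site P k) * (2 / (t ^ 2 * P.mesh k ^ P.d))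

/-- `K_t ≥ 1` for `t > 0`. [folklore] [cite: Balaban1983Higgs3, (1.19) p.416] -/
theorem one_le_sizeExpConst {t : ℝ} (ht : 0 < t) : 1 ≤ sizeExpConst P k t := by
  unfold sizeExpConst
  have := pow_pos (P.mesh_pos k) P.d
  have h1 : 0 ≤ t⁻¹ := by positivity
  have h2 : (0 : ℝ) ≤ Fintype.card (HiggsLattice.Site P k) * (2 / (t ^ 2 * P.mesh k ^ P.d)) := by positivity
  linarith

/-- **`R(A,φ) ≤ K_t · e^{tQ_A(A)} · e^{tQ(φ)}`** for every `t > 0` (polynomial weights are exponentially small perturbations of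
the Gaussian). [folklore] [cite: Balaban1983Higgs3, (1.19) p.416] -/
theorem size_le_exp {t : ℝ} (ht : 0 < t) (Φ : Cfg P k N) :
    size Φ ≤ sizeExpConst P k t * Real.exp (t * sqVec P k Φ.1) * Real.exp (t * sqMass P k Φ.2) := by
  have hA := sqVec_nonneg (P := P) (k := k) Φ.1
  have hM := sqMass_nonneg (P := P) (k := k) Φ.2
  have e1 : 1 ≤ Real.exp (t * sqVec P k Φ.1) := Real.one_le_exp (by positivity)
  have e2 : 1 ≤ Real.exp (t * sqMass P k Φ.2) := Real.one_le_exp (by positivity)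
  have h1 : sqVec P k Φ.1 ≤ t⁻¹ * Real.exp (t * sqVec P k Φ.1) := le_inv_mul_exp ht _
  have h2 := quartic_le_exp (P := P) (k := k) ht Φ.2
  have hc : (0 : ℝ) ≤ Fintype.card (HiggsLattice.Site P k) * (2 / (t ^ 2 * P.mesh k ^ P.d)) := by
    have := pow_pos (P.mesh_pos k) P.d
    positivity
  have ht' : 0 ≤ t⁻¹ := by positivity
  unfold size sizeExpConst
  set EA := Real.exp (t * sqVec P k Φ.1)
  set EM := Real.exp (t * sqMass P k Φ.2)
  set c := (Fintype.card (HiggsLattice.Site P k) : ℝ) * (2 / (t ^ 2 * P.mesh k ^ P.d))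
  have hEA : 0 ≤ EA := (Real.exp_pos _).le
  have hEM : 0 ≤ EM := (Real.exp_pos _).le
  calc 1 + sqVec P k Φ.1 + quartic P k Φ.2 ≤ EA * EM + t⁻¹ * EA * EM + c * EM * EA := by
        nlinarith [mul_le_mul e1 e2 zero_le_one hEA, mul_le_mul h1 e2 zero_le_one (mul_nonneg ht' hEA),
          mul_le_mul h2 e1 zero_le_one (mul_nonneg hc hEM)]
    _ = (1 + t⁻¹ + c) * EA * EM := by ring

/-- Hence `R^n ≤ K_t^n e^{ntQ_A} e^{ntQ}`. [folklore] [cite: Balaban1983Higgs3, (1.19) p.416] -/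
theorem size_pow_le_exp {t : ℝ} (ht : 0 < t) (n : ℕ) (Φ : Cfg P k N) :
    size Φ ^ n ≤ sizeExpConst P k t ^ n * Real.exp (n * t * sqVec P k Φ.1) * Real.exp (n * t * sqMass P k Φ.2) := by
  have h := pow_le_pow_left₀ (size_pos Φ).le (size_le_exp ht Φ) n
  rw [mul_pow, mul_pow, ← Real.exp_nat_mul, ← Real.exp_nat_mul] at h
  calc size Φ ^ n ≤ _ := h
    _ = _ := by ring_nf

/-- **Continuous observables of polynomial growth in BOTH fields, `|h| ≤ K·Rⁿ`, are integrable against the massive free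
weight `exp(−S^ε_{C,(m²,0,μ₀²,E)})`** for `m² > 0`, `μ₀² > 0`, ANY charge datum `C` (the covariant kinetic form is dropped:
`S ≥ E + ½μ₀²Q_A + ½m²Q`). [cite: Balaban1982Higgs1, (1.10) p.605] -/
theorem integrable_mul_exp_of_le_size_pow {msq mu0sq : ℝ} (hm : 0 < msq) (hmu : 0 < mu0sq)
    (C : HiggsLattice.ChargeData N) (E : ℝ) {h : Cfg P k N → ℝ} (hcont : Continuous h) {K : ℝ} {n : ℕ}
    (hb : ∀ Φ, |h Φ| ≤ K * size Φ ^ n) :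
    Integrable fun Φ : Cfg P k N => h Φ * Real.exp (-action C ⟨msq, 0, mu0sq, E⟩ Φ.1 Φ.2) := by
  have hη : 0 < P.mesh k ^ P.d := pow_pos (P.mesh_pos k) _
  have hK : 0 ≤ K := by
    have h0 := hb 0
    have hq : (0 : ℝ) < size (0 : Cfg P k N) ^ n := pow_pos (size_pos _) n
    nlinarith [abs_nonneg (h 0)]
  -- the rate `t`: `n t ≤ min(m², μ₀²)/4`
  set t : ℝ := min msq mu0sq / (4 * (n + 1)) with htdef
  have hmin : 0 < min msq mu0sq := lt_min hm hmu
  have ht : 0 < t := by rw [htdef]; positivity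
  have hnt : (n : ℝ) * t ≤ min msq mu0sq / 4 := by
    rw [htdef]
    have hn1 : (0 : ℝ) < n + 1 := by positivity
    rw [mul_div_assoc', div_le_div_iff₀ (by positivity) (by norm_num : (0 : ℝ) < 4)]
    nlinarith [hmin.le]
  have hntA : (n : ℝ) * t ≤ mu0sq / 4 := hnt.trans (by linarith [min_le_right msq mu0sq])
  have hntM : (n : ℝ) * t ≤ msq / 4 := hnt.trans (by linarith [min_le_left msq mu0sq])
  set Kt : ℝ := sizeExpConst P k t with hKt
  have hKt0 : 0 ≤ Kt := zero_le_one.trans (one_le_sizeExpConst ht)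
  have hmaj := (integrable_gauss (P := P) (k := k) (N := N) (a := P.mesh k ^ P.d * (mu0sq / 4))
    (c := P.mesh k ^ P.d * (msq / 4)) (by positivity) (by positivity)).const_mul (K * Kt ^ n * Real.exp (-E))
  refine hmaj.mono' (hcont.mul (Real.continuous_exp.comp (continuous_action C _).neg)).aestronglyMeasurable
    (Eventually.of_forall fun Φ => ?_)
  have hexp : 0 < Real.exp (-action C ⟨msq, 0, mu0sq, E⟩ Φ.1 Φ.2) := Real.exp_pos _
  rw [Real.norm_eq_abs, abs_mul, abs_of_pos hexp]
  -- the Gaussian minorant of the action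
  have hact := action_lam_zero_ge C msq mu0sq E Φ.1 Φ.2
  have eA : (∑ bd : HiggsLattice.PBond P k, P.mesh k ^ P.d * (mu0sq * (Φ.1 bd) ^ 2)) / 2 = mu0sq / 2 * sqVec P k Φ.1 := by
    unfold sqVec; rw [Finset.mul_sum, Finset.sum_div]; exact Finset.sum_congr rfl fun b _ => by ring
  have eM : ∑ x : HiggsLattice.Site P k, P.mesh k ^ P.d * (msq / 2 * ‖Φ.2 x‖ ^ 2) = msq / 2 * sqMass P k Φ.2 := by
    unfold sqMass; rw [Finset.mul_sum]; exact Finset.sum_congr rfl fun x _ => by ring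
  rw [eA, eM] at hact
  have hA0 := sqVec_nonneg (P := P) (k := k) Φ.1
  have hM0 := sqMass_nonneg (P := P) (k := k) Φ.2
  -- the products of one-dimensional Gaussians are `e^{−(μ₀²/4)Q_A}`, `e^{−(m²/4)Q}`
  have pA : ∏ bd : HiggsLattice.PBond P k, Real.exp (-(P.mesh k ^ P.d * (mu0sq / 4)) * (Φ.1 bd) ^ 2)
      = Real.exp (-(mu0sq / 4) * sqVec P k Φ.1) := by
    rw [← Real.exp_sum]; unfold sqVec; rw [Finset.mul_sum]
    congr 1; exact Finset.sum_congr rfl fun b _ => by ring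
  have pM : ∏ x : HiggsLattice.Site P k, Real.exp (-(P.mesh k ^ P.d * (msq / 4)) * ‖Φ.2 x‖ ^ 2)
      = Real.exp (-(msq / 4) * sqMass P k Φ.2) := by
    rw [← Real.exp_sum]; unfold sqMass; rw [Finset.mul_sum]
    congr 1; exact Finset.sum_congr rfl fun x _ => by ring
  rw [pA, pM]
  have hsz := size_pow_le_exp ht n Φ
  have hexp_le : Real.exp (-action C ⟨msq, 0, mu0sq, E⟩ Φ.1 Φ.2)
      ≤ Real.exp (-E) * Real.exp (-(mu0sq / 2) * sqVec P k Φ.1) * Real.exp (-(msq / 2) * sqMass P k Φ.2) := by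
    rw [← Real.exp_add, ← Real.exp_add, Real.exp_le_exp]; linarith
  have step1 : |h Φ| * Real.exp (-action C ⟨msq, 0, mu0sq, E⟩ Φ.1 Φ.2)
      ≤ (K * (Kt ^ n * Real.exp (n * t * sqVec P k Φ.1) * Real.exp (n * t * sqMass P k Φ.2)))
          * (Real.exp (-E) * Real.exp (-(mu0sq / 2) * sqVec P k Φ.1) * Real.exp (-(msq / 2) * sqMass P k Φ.2)) :=
    mul_le_mul ((hb Φ).trans (mul_le_mul_of_nonneg_left hsz hK)) hexp_le hexp.le (by positivity)
  refine step1.trans ?_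
  have cmb : K * (Kt ^ n * Real.exp (n * t * sqVec P k Φ.1) * Real.exp (n * t * sqMass P k Φ.2))
        * (Real.exp (-E) * Real.exp (-(mu0sq / 2) * sqVec P k Φ.1) * Real.exp (-(msq / 2) * sqMass P k Φ.2))
      = K * Kt ^ n * Real.exp (-E)
          * (Real.exp ((n * t - mu0sq / 2) * sqVec P k Φ.1) * Real.exp ((n * t - msq / 2) * sqMass P k Φ.2)) := by
    have e1 : Real.exp ((n * t - mu0sq / 2) * sqVec P k Φ.1)
        = Real.exp (n * t * sqVec P k Φ.1) * Real.exp (-(mu0sq / 2) * sqVec P k Φ.1) := by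
      rw [← Real.exp_add]; congr 1; ring
    have e2 : Real.exp ((n * t - msq / 2) * sqMass P k Φ.2)
        = Real.exp (n * t * sqMass P k Φ.2) * Real.exp (-(msq / 2) * sqMass P k Φ.2) := by
      rw [← Real.exp_add]; congr 1; ring
    rw [e1, e2]; ring
  rw [cmb]
  refine mul_le_mul_of_nonneg_left ?_ (by positivity)
  exact mul_le_mul (Real.exp_le_exp.2 (by nlinarith)) (Real.exp_le_exp.2 (by nlinarith)) (Real.exp_pos _).le
    (Real.exp_pos _).le

/-- Integrability against BRICK 4's un-normalized free measure `ν⁰`. [cite: Balaban1983Higgs3, (1.19) p.416] -/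
theorem integrable_freeMeasure_of_le_size_pow {msq mu0sq : ℝ} (hm : 0 < msq) (hmu : 0 < mu0sq)
    (C : HiggsLattice.ChargeData N) {h : Cfg P k N → ℝ} (hcont : Continuous h) {K : ℝ} {n : ℕ}
    (hb : ∀ Φ, |h Φ| ≤ K * size Φ ^ n) :
    Integrable h (freeMeasure P k N C msq mu0sq) := by
  rw [integrable_freeMeasure_iff]
  exact (integrable_mul_exp_of_le_size_pow hm hmu C 0 hcont hb).congr (Eventually.of_forall fun Φ => by ring)

end Integrability

/-! ## §1 Print's vertex TYPES as a colour family: `−𝒱(e) = Σ_c X_c`, charge orders, homogeneity, sizes -/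

section Colours

open Set
open HiggsLattice HiggsActionIntegrable B1Sect1Statements
open B1Eq113OneSidedDerivatives (quartic quartic_nonneg continuous_quartic)
open B3Eq18VertexExpansion (vertex16 vertex17 vertex18 vertex19 vertex110 vertex111 leg18 leg110 remTensor
  leg110_qpow_of_odd)
open B3VertexTensorBounds (norm_q_pow_le_one norm_qpow_mul_remOp_le_one)

variable {P : HiggsLattice.Params} {k N : ℕ}

/-- The vertex TYPES at charge-truncation order `n̄`: `inl 0` = (1.6), `inl 1` = (1.7), `inl 2` = the R-vertices
(1.9)_{n̄} + (1.11)_{n̄} (the charge orders `> n̄`, one colour); `inr (inl j)` = (1.8)_{j+1,0}, `inr (inr j)` = (1.10)_{j+1,0},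
`j < n̄` (charge orders `1 … n̄`). [cite: Balaban1983Higgs3, (1.6)–(1.11) p.413] -/
abbrev VType (nbar : ℕ) : Type := Fin 3 ⊕ (Fin nbar ⊕ Fin nbar)

/-- The CHARGE ORDER of a vertex type: `0` for (1.6)/(1.7), `j` for (1.8)_{j,0}/(1.10)_{j,0}, `n̄ + 1` for the R-vertices.
[cite: Balaban1983Higgs3, (1.8)–(1.11) p.413] -/
def ord (nbar : ℕ) : VType nbar → ℕ
  | Sum.inl i => ![0, 0, nbar + 1] i
  | Sum.inr (Sum.inl j) => j + 1
  | Sum.inr (Sum.inr j) => j + 1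

/-- GENUINE vertex types = those of charge order `≤ n̄` (print's (1.6), (1.7), (1.8), (1.10)); the two R-vertices have order
`n̄ + 1` (one colour for both). [cite: Balaban1983Higgs3, (1.21) p.416] -/
def Genuine (nbar : ℕ) (c : VType nbar) : Prop := ord nbar c ≤ nbar

/-- Genuineness is decidable (an inequality of naturals). [cite: Balaban1983Higgs3, (1.6)–(1.11) p.413] -/
instance (nbar : ℕ) (c : VType nbar) : Decidable (Genuine nbar c) := inferInstanceAs (Decidable (_ ≤ _))

/-- The type (1.6) exists. [cite: Balaban1983Higgs3, (1.6)–(1.11) p.413] -/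
instance (nbar : ℕ) : Nonempty (VType nbar) := ⟨Sum.inl 0⟩

/-- (1.6) has charge order `0`. [cite: Balaban1983Higgs3, (1.6)–(1.11) p.413] -/
@[simp] theorem ord_inl_zero (nbar : ℕ) : ord nbar (Sum.inl 0) = 0 := rfl
/-- (1.7) has charge order `0`. [cite: Balaban1983Higgs3, (1.6)–(1.11) p.413] -/
@[simp] theorem ord_inl_one (nbar : ℕ) : ord nbar (Sum.inl 1) = 0 := rfl
/-- The R-colour has charge order `n̄ + 1`. [cite: Balaban1983Higgs3, (1.6)–(1.11) p.413] -/
@[simp] theorem ord_inl_two (nbar : ℕ) : ord nbar (Sum.inl 2) = nbar + 1 := rfl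
/-- (1.8)_{j+1,0} has charge order `j + 1`. [cite: Balaban1983Higgs3, (1.6)–(1.11) p.413] -/
@[simp] theorem ord_inr_inl (nbar : ℕ) (j : Fin nbar) : ord nbar (Sum.inr (Sum.inl j)) = j + 1 := rfl
/-- (1.10)_{j+1,0} has charge order `j + 1`. [cite: Balaban1983Higgs3, (1.6)–(1.11) p.413] -/
@[simp] theorem ord_inr_inr (nbar : ℕ) (j : Fin nbar) : ord nbar (Sum.inr (Sum.inr j)) = j + 1 := rfl

/-- (1.6) is genuine. [cite: Balaban1983Higgs3, (1.6)–(1.11) p.413] -/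
theorem genuine_inl_zero (nbar : ℕ) : Genuine nbar (Sum.inl 0) := Nat.zero_le _
/-- (1.7) is genuine. [cite: Balaban1983Higgs3, (1.6)–(1.11) p.413] -/
theorem genuine_inl_one (nbar : ℕ) : Genuine nbar (Sum.inl 1) := Nat.zero_le _
/-- The R-colour is not genuine. [cite: Balaban1983Higgs3, (1.6)–(1.11) p.413] -/
theorem not_genuine_inl_two (nbar : ℕ) : ¬ Genuine nbar (Sum.inl 2) := Nat.not_succ_le_self _
/-- (1.8)_{j,0}, `j ≤ n̄`, is genuine. [cite: Balaban1983Higgs3, (1.6)–(1.11) p.413] -/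
theorem genuine_inr_inl (nbar : ℕ) (j : Fin nbar) : Genuine nbar (Sum.inr (Sum.inl j)) := Nat.succ_le_of_lt j.2
/-- (1.10)_{j,0}, `j ≤ n̄`, is genuine. [cite: Balaban1983Higgs3, (1.6)–(1.11) p.413] -/
theorem genuine_inr_inr (nbar : ℕ) (j : Fin nbar) : Genuine nbar (Sum.inr (Sum.inr j)) := Nat.succ_le_of_lt j.2
/-- Every type has charge order `≤ n̄ + 1`. [cite: Balaban1983Higgs3, (1.6)–(1.11) p.413] -/
theorem ord_le_succ (nbar : ℕ) (c : VType nbar) : ord nbar c ≤ nbar + 1 := by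
  rcases c with i | j | j
  · fin_cases i
    · exact Nat.zero_le _
    · exact Nat.zero_le _
    · exact le_rfl
  · exact (genuine_inr_inl nbar j).trans (Nat.le_succ _)
  · exact (genuine_inr_inr nbar j).trans (Nat.le_succ _)

/-- The only non-genuine type is the R-colour. [cite: Balaban1983Higgs3, (1.9)/(1.11) p.413] -/
theorem eq_inl_two_of_not_genuine {nbar : ℕ} {c : VType nbar} (hc : ¬ Genuine nbar c) : c = Sum.inl 2 := by
  rcases c with i | j | j
  · fin_cases i
    · exact absurd (genuine_inl_zero nbar) hc
    · exact absurd (genuine_inl_one nbar) hc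
    · rfl
  · exact absurd (genuine_inr_inl nbar j) hc
  · exact absurd (genuine_inr_inr nbar j) hc

/-- **The vertex of type `c`** as a function of the configuration `(A, φ)` of the torus (print's (1.6), (1.7), (1.8)_{j,0},
(1.10)_{j,0} at `B̃ = 0`, `g_k = 1`, `Ω₁ = T`, and the R-vertices (1.9)_{n̄}/(1.11)_{n̄} in the field `A`; typer's analytic
expressions `B3Eq18VertexExpansion.vertex16 … vertex111`). [cite: Balaban1983Higgs3, (1.6)–(1.11) p.413] -/
noncomputable def vtx (C : HiggsLattice.ChargeData N) (lam dm2 : ℝ) (nbar : ℕ) : VType nbar → Cfg P k N → ℝ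
  | Sum.inl i => fun Φ =>
      ![vertex16 lam Finset.univ Φ.2, vertex17 (fun _ => dm2) 1 Finset.univ Φ.2,
        vertex19 C (fun _ => (1 : ℝ)) 0 0 Φ.1 Φ.2 nbar 0 Finset.univ
          + vertex111 C (fun _ => (1 : ℝ)) 0 Φ.1 Φ.2 nbar 0 Finset.univ] i
  | Sum.inr (Sum.inl j) => fun Φ => vertex18 C (fun _ => (1 : ℝ)) 0 Φ.1 0 Φ.2 (j + 1) 0 Finset.univ
  | Sum.inr (Sum.inr j) => fun Φ => vertex110 C (fun _ => (1 : ℝ)) Φ.1 0 Φ.2 (j + 1) 0 Finset.univ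

/-- The type (1.6) is `vertex16`. [cite: Balaban1983Higgs3, (1.6)–(1.11) p.413] -/
@[simp] theorem vtx_inl_zero (C : HiggsLattice.ChargeData N) (lam dm2 : ℝ) (nbar : ℕ) (Φ : Cfg P k N) :
    vtx C lam dm2 nbar (Sum.inl 0) Φ = vertex16 lam Finset.univ Φ.2 := rfl
/-- The type (1.7) is `vertex17`. [cite: Balaban1983Higgs3, (1.6)–(1.11) p.413] -/
@[simp] theorem vtx_inl_one (C : HiggsLattice.ChargeData N) (lam dm2 : ℝ) (nbar : ℕ) (Φ : Cfg P k N) :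
    vtx C lam dm2 nbar (Sum.inl 1) Φ = vertex17 (fun _ => dm2) 1 Finset.univ Φ.2 := rfl
/-- The R-colour is `vertex19 + vertex111`. [cite: Balaban1983Higgs3, (1.6)–(1.11) p.413] -/
@[simp] theorem vtx_inl_two (C : HiggsLattice.ChargeData N) (lam dm2 : ℝ) (nbar : ℕ) (Φ : Cfg P k N) :
    vtx C lam dm2 nbar (Sum.inl 2) Φ = vertex19 C (fun _ => (1 : ℝ)) 0 0 Φ.1 Φ.2 nbar 0 Finset.univ
      + vertex111 C (fun _ => (1 : ℝ)) 0 Φ.1 Φ.2 nbar 0 Finset.univ := rfl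
/-- The type (1.8)_{j+1,0} is `vertex18 … (j+1) 0`. [cite: Balaban1983Higgs3, (1.6)–(1.11) p.413] -/
@[simp] theorem vtx_inr_inl (C : HiggsLattice.ChargeData N) (lam dm2 : ℝ) (nbar : ℕ) (j : Fin nbar) (Φ : Cfg P k N) :
    vtx C lam dm2 nbar (Sum.inr (Sum.inl j)) Φ = vertex18 C (fun _ => (1 : ℝ)) 0 Φ.1 0 Φ.2 (j + 1) 0 Finset.univ := rfl
/-- The type (1.10)_{j+1,0} is `vertex110 … (j+1) 0`. [cite: Balaban1983Higgs3, (1.6)–(1.11) p.413] -/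
@[simp] theorem vtx_inr_inr (C : HiggsLattice.ChargeData N) (lam dm2 : ℝ) (nbar : ℕ) (j : Fin nbar) (Φ : Cfg P k N) :
    vtx C lam dm2 nbar (Sum.inr (Sum.inr j)) Φ = vertex110 C (fun _ => (1 : ℝ)) Φ.1 0 Φ.2 (j + 1) 0 Finset.univ := rfl

/-- `Σ_{j ∈ {1,…,n}} f j = Σ_{i : Fin n} f (i + 1)`. [folklore] [cite: Balaban1983Higgs3, (1.6)–(1.11) p.413] -/
theorem sum_filter_one_le_range (f : ℕ → ℝ) (n : ℕ) :
    ∑ j ∈ (Finset.range (n + 1)).filter (fun j => 1 ≤ j), f j = ∑ i : Fin n, f (i + 1) := by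
  have hset : (Finset.range (n + 1)).filter (fun j => 1 ≤ j) = Finset.Ico 1 (n + 1) := by
    ext j
    simp only [Finset.mem_filter, Finset.mem_range, Finset.mem_Ico]
    omega
  rw [hset, Finset.sum_Ico_eq_sum_range, Nat.add_sub_cancel, Finset.sum_range]
  exact Finset.sum_congr rfl fun i _ => by rw [add_comm]

/-- A sum over the even orders `≥ 2` equals the sum over all orders `≥ 1` when the odd terms vanish. [folklore] [cite: Balaban1983Higgs3, (1.6)–(1.11) p.413] -/
theorem sum_filter_even_eq (g : ℕ → ℝ) (m : ℕ) (hg : ∀ j, Odd j → g j = 0) :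
    ∑ j ∈ (Finset.range m).filter (fun j => Even j ∧ 2 ≤ j), g j
      = ∑ j ∈ (Finset.range m).filter (fun j => 1 ≤ j), g j := by
  rw [Finset.sum_filter, Finset.sum_filter]
  refine Finset.sum_congr rfl fun j _ => ?_
  rcases Nat.even_or_odd j with hj | hj
  · obtain ⟨r, hr⟩ := hj
    by_cases h1 : 1 ≤ j
    · rw [if_pos ⟨⟨r, hr⟩, by omega⟩, if_pos h1]
    · rw [if_neg (fun h => h1 (by omega)), if_neg h1]
  · rw [hg j hj]
    simp

/-- (1.10)_{j,0} vanishes for odd `j` (`[v·q^j v] = 0`, print's «n + n′ even»). [cite: Balaban1983Higgs3, (1.10) p.413] -/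
theorem vertex110_odd (C : HiggsLattice.ChargeData N) (A : HiggsLattice.VecField P k)
    (φ : HiggsLattice.ScalarField P k N) {j : ℕ} (hj : Odd j) (S : Finset (HiggsLattice.PBond P k)) :
    vertex110 C (fun _ => (1 : ℝ)) A 0 φ j 0 S = 0 := by
  unfold vertex110
  rw [Finset.sum_eq_zero fun b _ => ?_, mul_zero]
  rw [leg110_qpow_of_odd C (by simpa using hj), mul_zero, zero_mul, zero_mul]

/-- **`−𝒱(e) = Σ_c X_c`**: minus the total vertex is the sum of the vertices of all types (FILE 1's dictionary
`neg_totalVertex_eq_vertices`, re-indexed). [cite: Balaban1983Higgs3, (1.21) p.416] -/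
theorem neg_totalVertex_eq_sum_vtx (C : HiggsLattice.ChargeData N) (lam dm2 : ℝ) (nbar : ℕ) (Φ : Cfg P k N) :
    -totalVertex C lam dm2 Φ = ∑ c : VType nbar, vtx C lam dm2 nbar c Φ := by
  rw [Fintype.sum_sum_type, Fintype.sum_sum_type, Fin.sum_univ_three]
  have h := neg_totalVertex_eq_vertices C lam dm2 Φ.1 Φ.2 nbar
  rw [Prod.mk.eta] at h
  rw [h, sum_filter_even_eq _ _ (fun j hj => vertex110_odd C Φ.1 Φ.2 hj _),
    sum_filter_one_le_range (fun j => vertex18 C (fun _ => (1 : ℝ)) 0 Φ.1 0 Φ.2 j 0 Finset.univ) nbar,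
    sum_filter_one_le_range (fun j => vertex110 C (fun _ => (1 : ℝ)) Φ.1 0 Φ.2 j 0 Finset.univ) nbar]
  simp only [vtx, Matrix.cons_val_zero, Matrix.cons_val_one]
  have e2 : (![vertex16 lam Finset.univ Φ.2, vertex17 (fun _ => dm2) 1 Finset.univ Φ.2,
        vertex19 C (fun _ => (1 : ℝ)) 0 0 Φ.1 Φ.2 nbar 0 Finset.univ
          + vertex111 C (fun _ => (1 : ℝ)) 0 Φ.1 Φ.2 nbar 0 Finset.univ] : Fin 3 → ℝ) 2
      = vertex19 C (fun _ => (1 : ℝ)) 0 0 Φ.1 Φ.2 nbar 0 Finset.univ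
          + vertex111 C (fun _ => (1 : ℝ)) 0 Φ.1 Φ.2 nbar 0 Finset.univ := rfl
  rw [e2]
  ring

/-! ### Charge homogeneity of the genuine vertices and the `O(e^{n̄+1})` size of the R-vertices -/

/-- The charge datum `(e, q) ↦ (1, q)`: the charge-free («amputated of its coupling constant») form of a vertex is its
value at `e = 1`. [cite: Balaban1983Higgs3, (1.21) p.416] -/
def chargeOne (C : HiggsLattice.ChargeData N) : HiggsLattice.ChargeData N := { C with e := 1 }

/-- Unit charge. [cite: Balaban1983Higgs3, (1.21) p.416] -/
@[simp] theorem chargeOne_e (C : HiggsLattice.ChargeData N) : (chargeOne C).e = 1 := rfl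

/-- Same generator `q`. [cite: Balaban1983Higgs3, (1.21) p.416] -/
@[simp] theorem chargeOne_q (C : HiggsLattice.ChargeData N) : (chargeOne C).q = C.q := rfl

/-- The (1.8) leg bracket at `B̃ = 0` does not depend on the charge (`D^η_0 = ∂^η`). [cite: Balaban1983Higgs3, (1.8) p.413] -/
theorem leg18_zero_eq (C C' : HiggsLattice.ChargeData N) (φ : HiggsLattice.ScalarField P k N)
    (T : B3Eq18VertexExpansion.Op N) (b : HiggsLattice.PBond P k) : leg18 C 0 φ T b = leg18 C' 0 φ T b := by
  unfold leg18
  rw [covDeriv_zero, covDeriv_zero]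

/-- **Charge homogeneity**: a GENUINE vertex of type `c` carries exactly the power `e^{ord c}` of the charge —
`X_c(e) = e^{ord c} · X_c(1)` ((1.8)_{j,0}, (1.10)_{j,0} carry `(e(L^kε))^{j}`, (1.6)/(1.7) carry none).
[cite: Balaban1983Higgs3, (1.8)–(1.10) p.413] -/
theorem vtx_eq_pow_mul_chargeOne (C : HiggsLattice.ChargeData N) (lam dm2 : ℝ) (nbar : ℕ) {c : VType nbar}
    (hc : Genuine nbar c) (Φ : Cfg P k N) :
    vtx C lam dm2 nbar c Φ = C.e ^ ord nbar c * vtx (chargeOne C) lam dm2 nbar c Φ := by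
  rcases c with i | j | j
  · fin_cases i
    · simp [vtx, ord]
    · simp [vtx, ord]
    · exact absurd hc (not_genuine_inl_two nbar)
  · simp only [vtx, ord]
    unfold vertex18
    simp only [chargeOne_e, chargeOne_q, one_pow, one_mul, add_zero, leg18_zero_eq (chargeOne C) C]
    ring
  · simp only [vtx, ord]
    unfold vertex110
    simp only [chargeOne_e, chargeOne_q, one_pow, one_mul, add_zero]
    ring

/-- The charge-free majorant of the R-vertex (1.9)_{n̄}: `η^{n̄}/(n̄+1)! · Σ_b η^d |∂φ(b)||φ(b₋)||A_b|^{n̄+1}`.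
[cite: Balaban1983Higgs3, (1.9) p.413] -/
noncomputable def rhat19 (P : HiggsLattice.Params) (k : ℕ) (nbar : ℕ) (Φ : Cfg P k N) : ℝ :=
  P.mesh k ^ nbar / ((nbar + 1).factorial : ℝ)
    * ∑ b : HiggsLattice.PBond P k, P.mesh k ^ P.d * (‖sderiv Φ.2 b‖ * ‖Φ.2 b.src‖) * |Φ.1 b| ^ (nbar + 1)

/-- The charge-free majorant of the R-vertex (1.11)_{n̄}: `η^{n̄−1}/(n̄+1)! · Σ_b η^d |φ(b₋)|²|A_b|^{n̄+1}`.
[cite: Balaban1983Higgs3, (1.11) p.413] -/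
noncomputable def rhat111 (P : HiggsLattice.Params) (k : ℕ) (nbar : ℕ) (Φ : Cfg P k N) : ℝ :=
  P.mesh k ^ ((nbar : ℤ) - 1) / ((nbar + 1).factorial : ℝ)
    * ∑ b : HiggsLattice.PBond P k, P.mesh k ^ P.d * ‖Φ.2 b.src‖ ^ 2 * |Φ.1 b| ^ (nbar + 1)

/-- `|[x·Tv]| ≤ |x||v|` for `‖T‖ ≤ 1`. [folklore] -/
private theorem abs_inner_le_of_norm_le_one {T : B3Eq18VertexExpansion.Op N} (hT : ‖T‖ ≤ 1)
    (x v : EuclideanSpace ℝ (Fin N)) : |⟪x, T v⟫_ℝ| ≤ ‖x‖ * ‖v‖ :=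
  (abs_real_inner_le_norm _ _).trans (mul_le_mul_of_nonneg_left
    ((T.le_opNorm v).trans (by nlinarith [norm_nonneg v])) (norm_nonneg _))

/-- **The R-vertex (1.9)_{n̄} is `O(e^{n̄+1})`**: `|(1.9)_{n̄}(A,φ)| ≤ |e|^{n̄+1}·R̂₉(A,φ)` with `R̂₉` charge-free
(`|R_{n̄+1}(·)| ≦ 1`, `‖q‖ ≦ 1`, p. 414). [cite: Balaban1983Higgs3, (1.9) p.413] -/
theorem abs_vertex19_le (C : HiggsLattice.ChargeData N) (nbar : ℕ) (Φ : Cfg P k N) :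
    |vertex19 C (fun _ => (1 : ℝ)) 0 0 Φ.1 Φ.2 nbar 0 Finset.univ| ≤ |C.e| ^ (nbar + 1) * rhat19 P k nbar Φ := by
  have hη : 0 < P.mesh k := P.mesh_pos k
  unfold vertex19 rhat19
  simp only [zero_add, pow_zero, mul_one, Nat.factorial_zero, Nat.cast_one, one_mul]
  have hpref : |(-1 : ℝ) ^ (nbar + 1) * P.mesh k ^ nbar / ((nbar + 1).factorial : ℝ)|
      = P.mesh k ^ nbar / ((nbar + 1).factorial : ℝ) := by
    rw [abs_div, abs_mul, abs_pow, abs_neg, abs_one, one_pow, one_mul, abs_of_pos (pow_pos hη _),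
      abs_of_pos (by positivity)]
  have hb : ∀ b : HiggsLattice.PBond P k,
      |P.mesh k ^ P.d * leg18 C 0 Φ.2 (C.q ^ (nbar + 1) * remTensor C nbar Φ.1 b) b * Φ.1 b ^ (nbar + 1)|
        ≤ P.mesh k ^ P.d * (‖sderiv Φ.2 b‖ * ‖Φ.2 b.src‖) * |Φ.1 b| ^ (nbar + 1) := by
    intro b
    have hT := norm_qpow_mul_remOp_le_one C (nbar + 1) nbar (-(P.mesh k * C.e * Φ.1 b))
    have hleg : |leg18 C 0 Φ.2 (C.q ^ (nbar + 1) * remTensor C nbar Φ.1 b) b| ≤ ‖sderiv Φ.2 b‖ * ‖Φ.2 b.src‖ := by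
      unfold leg18 remTensor
      rw [covDeriv_zero]
      exact abs_inner_le_of_norm_le_one hT _ _
    rw [abs_mul, abs_mul, abs_of_pos (pow_pos (P.mesh_pos k) _), abs_pow]
    gcongr
  rw [abs_mul, abs_mul, abs_pow, hpref, mul_assoc]
  gcongr
  exact (Finset.abs_sum_le_sum_abs _ _).trans (Finset.sum_le_sum fun b _ => hb b)

/-- **The R-vertex (1.11)_{n̄} is `O(e^{n̄+1})`**: `|(1.11)_{n̄}(A,φ)| ≤ |e|^{n̄+1}·R̂₁₁(A,φ)`. [cite: Balaban1983Higgs3, (1.11) p.413] -/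
theorem abs_vertex111_le (C : HiggsLattice.ChargeData N) (nbar : ℕ) (Φ : Cfg P k N) :
    |vertex111 C (fun _ => (1 : ℝ)) 0 Φ.1 Φ.2 nbar 0 Finset.univ| ≤ |C.e| ^ (nbar + 1) * rhat111 P k nbar Φ := by
  have hη : 0 < P.mesh k := P.mesh_pos k
  unfold vertex111 rhat111
  simp only [zero_add, pow_zero, mul_one, Nat.factorial_zero, Nat.cast_one, one_mul, Nat.cast_zero]
  have hpref : |(-1 : ℝ) ^ (nbar + 1) * P.mesh k ^ ((nbar : ℤ) - 1) / ((nbar + 1).factorial : ℝ)|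
      = P.mesh k ^ ((nbar : ℤ) - 1) / ((nbar + 1).factorial : ℝ) := by
    rw [abs_div, abs_mul, abs_pow, abs_neg, abs_one, one_pow, one_mul, abs_of_pos (zpow_pos hη _),
      abs_of_pos (by positivity)]
  have hb : ∀ b : HiggsLattice.PBond P k,
      |P.mesh k ^ P.d * leg110 Φ.2 (C.q ^ (nbar + 1) * remTensor C nbar Φ.1 b) b * Φ.1 b ^ (nbar + 1)|
        ≤ P.mesh k ^ P.d * ‖Φ.2 b.src‖ ^ 2 * |Φ.1 b| ^ (nbar + 1) := by
    intro b
    have hT := norm_qpow_mul_remOp_le_one C (nbar + 1) nbar (-(P.mesh k * C.e * Φ.1 b))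
    have hleg : |leg110 Φ.2 (C.q ^ (nbar + 1) * remTensor C nbar Φ.1 b) b| ≤ ‖Φ.2 b.src‖ ^ 2 := by
      unfold leg110 remTensor
      rw [sq]
      exact abs_inner_le_of_norm_le_one hT _ _
    rw [abs_mul, abs_mul, abs_of_pos (pow_pos (P.mesh_pos k) _), abs_pow]
    gcongr
  have hz : 0 ≤ P.mesh k ^ ((nbar : ℤ) - 1) / ((nbar + 1).factorial : ℝ) := by
    have := zpow_pos hη ((nbar : ℤ) - 1)
    positivity
  rw [abs_mul, abs_mul, abs_pow, hpref, mul_assoc]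
  gcongr
  exact (Finset.abs_sum_le_sum_abs _ _).trans (Finset.sum_le_sum fun b _ => hb b)

/-! ### Sizes: every vertex type has polynomial growth `≤ K·R^{n̄+3}` in the size `R` of §0 -/

/-- The universal constant `c₀ = 2(1 + η⁻¹)(2 + η^{−d})` of the elementary size bounds. [folklore] -/
noncomputable def c0 (P : HiggsLattice.Params) (k : ℕ) : ℝ := 2 * (1 + (P.mesh k)⁻¹) * (2 + (P.mesh k ^ P.d)⁻¹)

/-- `c₀ ≥ 1`. [cite: Balaban1983Higgs3, (1.6)–(1.11) p.413] -/
theorem one_le_c0 : 1 ≤ c0 P k := by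
  unfold c0
  have h1 : 0 ≤ (P.mesh k)⁻¹ := inv_nonneg.2 (P.mesh_pos k).le
  have h2 : 0 ≤ (P.mesh k ^ P.d)⁻¹ := inv_nonneg.2 (pow_nonneg (P.mesh_pos k).le _)
  nlinarith

/-- `|φ(x)| ≤ (2 + η^{−d})·R` (the sharp elementary bound). [folklore] [cite: Balaban1983Higgs3, (1.6)–(1.11) p.413] -/
theorem norm_phi_le_size' (Φ : Cfg P k N) (x : HiggsLattice.Site P k) : ‖Φ.2 x‖ ≤ (2 + (P.mesh k ^ P.d)⁻¹) * size Φ := by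
  have hq := norm_sq_le_quartic Φ.2 x
  have hS := one_le_size Φ
  have hηd : 0 ≤ (P.mesh k ^ P.d)⁻¹ := inv_nonneg.2 (pow_nonneg (P.mesh_pos k).le _)
  have hquart : quartic P k Φ.2 ≤ size Φ := by
    unfold size; have := sqVec_nonneg (P := P) (k := k) Φ.1; linarith
  have h1 : ‖Φ.2 x‖ ≤ ‖Φ.2 x‖ ^ 2 + 1 := by nlinarith [sq_nonneg (‖Φ.2 x‖ - 1)]
  nlinarith [mul_le_mul_of_nonneg_left hquart hηd]

/-- `|φ(x)| ≤ c₀·R`. [folklore] [cite: Balaban1983Higgs3, (1.6)–(1.11) p.413] -/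
theorem norm_phi_le_size (Φ : Cfg P k N) (x : HiggsLattice.Site P k) : ‖Φ.2 x‖ ≤ c0 P k * size Φ := by
  have h := norm_phi_le_size' Φ x
  have hη1 : 0 ≤ (P.mesh k)⁻¹ := inv_nonneg.2 (P.mesh_pos k).le
  have hpos : (0 : ℝ) ≤ (2 + (P.mesh k ^ P.d)⁻¹) * size Φ := by
    have := one_le_size Φ; have : 0 ≤ (P.mesh k ^ P.d)⁻¹ := inv_nonneg.2 (pow_nonneg (P.mesh_pos k).le _)
    positivity
  unfold c0
  nlinarith [mul_nonneg hη1 hpos]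

/-- `|A_b| ≤ c₀·R`. [folklore] [cite: Balaban1983Higgs3, (1.6)–(1.11) p.413] -/
theorem abs_vec_le_size (Φ : Cfg P k N) (b : HiggsLattice.PBond P k) : |Φ.1 b| ≤ c0 P k * size Φ := by
  have hη : 0 < P.mesh k ^ P.d := pow_pos (P.mesh_pos k) _
  have hS := one_le_size Φ
  have hηd : 0 ≤ (P.mesh k ^ P.d)⁻¹ := inv_nonneg.2 hη.le
  have hη1 : 0 ≤ (P.mesh k)⁻¹ := inv_nonneg.2 (P.mesh_pos k).le
  have hsq : P.mesh k ^ P.d * Φ.1 b ^ 2 ≤ sqVec P k Φ.1 :=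
    Finset.single_le_sum (f := fun bd => P.mesh k ^ P.d * Φ.1 bd ^ 2)
      (fun bd _ => mul_nonneg hη.le (sq_nonneg _)) (Finset.mem_univ b)
  have hsq' : Φ.1 b ^ 2 ≤ (P.mesh k ^ P.d)⁻¹ * sqVec P k Φ.1 := by
    rw [le_inv_mul_iff₀ hη]; exact hsq
  have hvec : sqVec P k Φ.1 ≤ size Φ := by
    unfold size; have := quartic_nonneg (P := P) (k := k) Φ.2; linarith
  have h1 : |Φ.1 b| ≤ Φ.1 b ^ 2 + 1 := by nlinarith [sq_nonneg (|Φ.1 b| - 1), sq_abs (Φ.1 b), abs_nonneg (Φ.1 b)]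
  have h2 : Φ.1 b ^ 2 + 1 ≤ (2 + (P.mesh k ^ P.d)⁻¹) * size Φ := by
    nlinarith [mul_le_mul_of_nonneg_left hvec hηd]
  unfold c0
  nlinarith [mul_nonneg hη1 (by positivity : (0 : ℝ) ≤ (2 + (P.mesh k ^ P.d)⁻¹) * size Φ)]

/-- `|∂φ(b)| ≤ c₀·R` (`c₀ = 2(1+η⁻¹)(2+η^{−d}) ≥ 2η⁻¹(2+η^{−d})`). [folklore] [cite: Balaban1983Higgs3, (1.6)–(1.11) p.413] -/
theorem norm_sderiv_le_size (Φ : Cfg P k N) (b : HiggsLattice.PBond P k) : ‖sderiv Φ.2 b‖ ≤ c0 P k * size Φ := by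
  have hη : 0 < P.mesh k := P.mesh_pos k
  have h1 := norm_phi_le_size' Φ b.tgt
  have h2 := norm_phi_le_size' Φ b.src
  have hpos : 0 ≤ (2 + (P.mesh k ^ P.d)⁻¹) * size Φ := by
    have := one_le_size Φ; have : 0 ≤ (P.mesh k ^ P.d)⁻¹ := inv_nonneg.2 (pow_nonneg hη.le _); positivity
  unfold sderiv
  rw [norm_smul, Real.norm_eq_abs, abs_of_pos (inv_pos.2 hη)]
  have h3 : ‖Φ.2 b.tgt - Φ.2 b.src‖ ≤ ‖Φ.2 b.tgt‖ + ‖Φ.2 b.src‖ := norm_sub_le _ _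
  have h4 : (P.mesh k)⁻¹ * ‖Φ.2 b.tgt - Φ.2 b.src‖ ≤ (P.mesh k)⁻¹ * (2 * ((2 + (P.mesh k ^ P.d)⁻¹) * size Φ)) :=
    mul_le_mul_of_nonneg_left (h3.trans (by linarith)) (inv_nonneg.2 hη.le)
  refine h4.trans ?_
  unfold c0
  nlinarith [mul_nonneg (inv_nonneg.2 hη.le) hpos]

/-- The bond monomial bound: `u·v·w^m ≤ (c₀R)^{n̄+3}` for `u, v, w ≤ c₀R` and `m ≤ n̄ + 1`. [folklore] [cite: Balaban1983Higgs3, (1.6)–(1.11) p.413] -/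
theorem bond_term_le (nbar : ℕ) (Φ : Cfg P k N) {u v w : ℝ} (hv0 : 0 ≤ v) (hw0 : 0 ≤ w)
    (hu : u ≤ c0 P k * size Φ) (hv : v ≤ c0 P k * size Φ) (hw : w ≤ c0 P k * size Φ) {m : ℕ} (hm : m ≤ nbar + 1) :
    u * v * w ^ m ≤ (c0 P k * size Φ) ^ (nbar + 3) := by
  have hcS : 1 ≤ c0 P k * size Φ := one_le_mul_of_one_le_of_one_le one_le_c0 (one_le_size Φ)
  calc u * v * w ^ m ≤ (c0 P k * size Φ) * (c0 P k * size Φ) * (c0 P k * size Φ) ^ m := by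
        gcongr
    _ = (c0 P k * size Φ) ^ (m + 2) := by ring
    _ ≤ (c0 P k * size Φ) ^ (nbar + 3) := pow_le_pow_right₀ hcS (by omega)

/-- The uniform size constant of the charged vertex types: `#bonds · η^{d} · (1 + η⁻¹ + η^{n̄}) · c₀^{n̄+3}` (generous). [folklore] -/
noncomputable def vtxConst (P : HiggsLattice.Params) (k : ℕ) (nbar : ℕ) : ℝ :=
  Fintype.card (HiggsLattice.PBond P k) * P.mesh k ^ P.d * ((P.mesh k)⁻¹ + (1 + P.mesh k) ^ nbar * (1 + (P.mesh k)⁻¹ ^ 2))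
    * c0 P k ^ (nbar + 3)

/-- `K_vtx ≥ 0`. [cite: Balaban1983Higgs3, (1.6)–(1.11) p.413] -/
theorem vtxConst_nonneg (nbar : ℕ) : 0 ≤ vtxConst P k nbar := by
  unfold vtxConst
  have := P.mesh_pos k
  have := one_le_c0 (P := P) (k := k)
  positivity

/-- `η^j/(j)! … ≤ (1+η)^{n̄}(1 + η⁻²)`-type control of the printed prefactors `η^{j−1}/j!`, `η^{j−2}/j!` (`j ≤ n̄+1`). [folklore] [cite: Balaban1983Higgs3, (1.6)–(1.11) p.413] -/
theorem prefactor_le {nbar j : ℕ} (hj : j ≤ nbar + 1) (z : ℤ) (hz : z = (j : ℤ) - 1 ∨ z = (j : ℤ) - 2) :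
    P.mesh k ^ z / (j.factorial : ℝ) ≤ (P.mesh k)⁻¹ + (1 + P.mesh k) ^ nbar * (1 + (P.mesh k)⁻¹ ^ 2) := by
  have hη : 0 < P.mesh k := P.mesh_pos k
  have hfac : (1 : ℝ) ≤ j.factorial := by exact_mod_cast Nat.one_le_iff_ne_zero.mpr (Nat.factorial_ne_zero j)
  have hdiv : P.mesh k ^ z / (j.factorial : ℝ) ≤ P.mesh k ^ z :=
    div_le_self (zpow_nonneg hη.le _) hfac
  refine hdiv.trans ?_
  have hpow : ∀ m : ℕ, m ≤ nbar → P.mesh k ^ m ≤ (1 + P.mesh k) ^ nbar := fun m hm =>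
    (pow_le_pow_left₀ hη.le (by linarith) m).trans (pow_le_pow_right₀ (by linarith) hm)
  have hinv : 0 ≤ (P.mesh k)⁻¹ := inv_nonneg.2 hη.le
  have h1η : 1 ≤ (1 + P.mesh k) ^ nbar := one_le_pow₀ (by linarith)
  rcases hz with rfl | rfl
  · -- `z = j - 1`
    rcases Nat.eq_zero_or_pos j with rfl | hjpos
    · simp only [Nat.cast_zero, zero_sub, zpow_neg, zpow_one]
      nlinarith [mul_nonneg (zero_le_one.trans h1η) (sq_nonneg ((P.mesh k)⁻¹))]
    · have e : ((j : ℤ) - 1) = ((j - 1 : ℕ) : ℤ) := by omega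
      rw [e, zpow_natCast]
      have := hpow (j - 1) (by omega)
      nlinarith [mul_nonneg (zero_le_one.trans h1η) (sq_nonneg ((P.mesh k)⁻¹))]
  · -- `z = j - 2`
    rcases Nat.lt_or_ge j 2 with hj2 | hj2
    · interval_cases j
      · simp only [Nat.cast_zero, zero_sub]
        rw [show (-2 : ℤ) = -((2 : ℕ) : ℤ) by norm_num, zpow_neg, zpow_natCast, ← inv_pow]
        nlinarith [sq_nonneg ((P.mesh k)⁻¹)]
      · simp only [Nat.cast_one]
        rw [show ((1 : ℤ) - 2) = -1 by norm_num, zpow_neg, zpow_one]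
        nlinarith [mul_nonneg (zero_le_one.trans h1η) (sq_nonneg ((P.mesh k)⁻¹))]
    · have e : ((j : ℤ) - 2) = ((j - 2 : ℕ) : ℤ) := by omega
      rw [e, zpow_natCast]
      have := hpow (j - 2) (by omega)
      nlinarith [mul_nonneg (zero_le_one.trans h1η) (sq_nonneg ((P.mesh k)⁻¹))]

/-- **Size of the charged vertices at unit charge**: `|(1.8)_{j,0}|, |(1.10)_{j,0}| ≤ K_vtx·R^{n̄+3}` (`j ≤ n̄`).
[cite: Balaban1983Higgs3, (1.8)–(1.10) p.413] -/
theorem abs_vtx_charged_le (C : HiggsLattice.ChargeData N) (lam dm2 : ℝ) (nbar : ℕ) (j : Fin nbar) (Φ : Cfg P k N) :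
    |vtx (chargeOne C) lam dm2 nbar (Sum.inr (Sum.inl j)) Φ| ≤ vtxConst P k nbar * size Φ ^ (nbar + 3)
    ∧ |vtx (chargeOne C) lam dm2 nbar (Sum.inr (Sum.inr j)) Φ| ≤ vtxConst P k nbar * size Φ ^ (nbar + 3) := by
  have hη : 0 < P.mesh k := P.mesh_pos k
  have hηd : 0 < P.mesh k ^ P.d := pow_pos hη _
  have hj : (j : ℕ) + 1 ≤ nbar + 1 := by omega
  set M : ℝ := (P.mesh k)⁻¹ + (1 + P.mesh k) ^ nbar * (1 + (P.mesh k)⁻¹ ^ 2) with hM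
  have hM0 : 0 ≤ M := by rw [hM]; positivity
  -- each bond term is at most `η^d (c₀R)^{n̄+3}`
  have hb18 : ∀ b : HiggsLattice.PBond P k,
      |P.mesh k ^ P.d * leg18 (chargeOne C) 0 Φ.2 ((chargeOne C).q ^ ((j : ℕ) + 1 + 0)) b
          * ((fun _ => (1 : ℝ)) b.src * Φ.1 b) ^ ((j : ℕ) + 1) * (0 : HiggsLattice.VecField P k) b ^ 0|
        ≤ P.mesh k ^ P.d * (c0 P k * size Φ) ^ (nbar + 3) := by
    intro b
    rw [pow_zero, mul_one, one_mul, add_zero, abs_mul, abs_mul, abs_of_pos hηd, abs_pow]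
    have hleg : |leg18 (chargeOne C) 0 Φ.2 (C.q ^ ((j : ℕ) + 1)) b| ≤ ‖sderiv Φ.2 b‖ * ‖Φ.2 b.src‖ := by
      unfold leg18; rw [covDeriv_zero]
      exact abs_inner_le_of_norm_le_one (norm_q_pow_le_one C _) _ _
    rw [chargeOne_q, mul_assoc]
    refine mul_le_mul_of_nonneg_left ?_ hηd.le
    calc |leg18 (chargeOne C) 0 Φ.2 (C.q ^ ((j : ℕ) + 1)) b| * |Φ.1 b| ^ ((j : ℕ) + 1)
        ≤ ‖sderiv Φ.2 b‖ * ‖Φ.2 b.src‖ * |Φ.1 b| ^ ((j : ℕ) + 1) := by gcongr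
      _ ≤ (c0 P k * size Φ) ^ (nbar + 3) :=
          bond_term_le nbar Φ (norm_nonneg _) (abs_nonneg _) (norm_sderiv_le_size Φ b) (norm_phi_le_size Φ _)
            (abs_vec_le_size Φ b) hj
  have hb110 : ∀ b : HiggsLattice.PBond P k,
      |P.mesh k ^ P.d * leg110 Φ.2 ((chargeOne C).q ^ ((j : ℕ) + 1 + 0)) b
          * ((fun _ => (1 : ℝ)) b.src * Φ.1 b) ^ ((j : ℕ) + 1) * (0 : HiggsLattice.VecField P k) b ^ 0|
        ≤ P.mesh k ^ P.d * (c0 P k * size Φ) ^ (nbar + 3) := by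
    intro b
    rw [pow_zero, mul_one, one_mul, add_zero, abs_mul, abs_mul, abs_of_pos hηd, abs_pow]
    have hleg : |leg110 Φ.2 (C.q ^ ((j : ℕ) + 1)) b| ≤ ‖Φ.2 b.src‖ * ‖Φ.2 b.src‖ := by
      unfold leg110
      exact abs_inner_le_of_norm_le_one (norm_q_pow_le_one C _) _ _
    rw [chargeOne_q, mul_assoc]
    refine mul_le_mul_of_nonneg_left ?_ hηd.le
    calc |leg110 Φ.2 (C.q ^ ((j : ℕ) + 1)) b| * |Φ.1 b| ^ ((j : ℕ) + 1)
        ≤ ‖Φ.2 b.src‖ * ‖Φ.2 b.src‖ * |Φ.1 b| ^ ((j : ℕ) + 1) := by gcongr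
      _ ≤ (c0 P k * size Φ) ^ (nbar + 3) :=
          bond_term_le nbar Φ (norm_nonneg _) (abs_nonneg _) (norm_phi_le_size Φ _) (norm_phi_le_size Φ _)
            (abs_vec_le_size Φ b) hj
  have hsum18 := (Finset.abs_sum_le_sum_abs _ _).trans (Finset.sum_le_sum fun b (_ : b ∈ Finset.univ) => hb18 b)
  have hsum110 := (Finset.abs_sum_le_sum_abs _ _).trans (Finset.sum_le_sum fun b (_ : b ∈ Finset.univ) => hb110 b)
  rw [Finset.sum_const, Finset.card_univ, nsmul_eq_mul] at hsum18 hsum110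
  have hfinal : ∀ (pref : ℝ), |pref| ≤ M →
      |pref| * (Fintype.card (HiggsLattice.PBond P k) * (P.mesh k ^ P.d * (c0 P k * size Φ) ^ (nbar + 3)))
        ≤ vtxConst P k nbar * size Φ ^ (nbar + 3) := by
    intro pref hp
    unfold vtxConst
    rw [mul_pow]
    have : 0 ≤ (Fintype.card (HiggsLattice.PBond P k) : ℝ) * (P.mesh k ^ P.d * (c0 P k ^ (nbar + 3) * size Φ ^ (nbar + 3))) := by
      have := one_le_c0 (P := P) (k := k); have := size_pos Φ; positivity
    calc |pref| * (Fintype.card (HiggsLattice.PBond P k) * (P.mesh k ^ P.d * (c0 P k ^ (nbar + 3) * size Φ ^ (nbar + 3))))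
        ≤ M * (Fintype.card (HiggsLattice.PBond P k) * (P.mesh k ^ P.d * (c0 P k ^ (nbar + 3) * size Φ ^ (nbar + 3)))) :=
          mul_le_mul_of_nonneg_right hp this
      _ = _ := by rw [hM]; ring
  constructor
  · simp only [vtx]
    unfold vertex18
    rw [abs_mul, abs_mul, chargeOne_e, one_pow, abs_one, one_mul]
    have hp : |(-1 : ℝ) ^ ((j : ℕ) + 1 + 0) * P.mesh k ^ (((j : ℕ) + 1 + 0 : ℕ) - 1 : ℤ)
        / ((((j : ℕ) + 1).factorial : ℝ) * (Nat.factorial 0 : ℝ))| ≤ M := by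
      rw [add_zero, Nat.factorial_zero, Nat.cast_one, mul_one, abs_div, abs_mul, abs_pow, abs_neg, abs_one, one_pow,
        one_mul, abs_of_pos (zpow_pos hη _), abs_of_pos (by positivity)]
      exact prefactor_le hj _ (Or.inl (by push_cast; ring))
    exact (mul_le_mul_of_nonneg_left hsum18 (abs_nonneg _)).trans (hfinal _ hp)
  · simp only [vtx]
    unfold vertex110
    rw [abs_mul, abs_mul, chargeOne_e, one_pow, abs_one, one_mul]
    have hp : |P.mesh k ^ (((j : ℕ) + 1 + 0 : ℕ) - 2 : ℤ) / ((((j : ℕ) + 1).factorial : ℝ) * (Nat.factorial 0 : ℝ))| ≤ M := by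
      rw [add_zero, Nat.factorial_zero, Nat.cast_one, mul_one, abs_div, abs_of_pos (zpow_pos hη _),
        abs_of_pos (by positivity)]
      exact prefactor_le hj _ (Or.inr (by push_cast; ring))
    exact (mul_le_mul_of_nonneg_left hsum110 (abs_nonneg _)).trans (hfinal _ hp)

/-- **Size of the R-vertex majorants**: `R̂₉, R̂₁₁ ≤ K_vtx·R^{n̄+3}`. [cite: Balaban1983Higgs3, (1.9)–(1.11) p.413] -/
theorem rhat_le (nbar : ℕ) (Φ : Cfg P k N) :
    rhat19 P k nbar Φ ≤ vtxConst P k nbar * size Φ ^ (nbar + 3)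
    ∧ rhat111 P k nbar Φ ≤ vtxConst P k nbar * size Φ ^ (nbar + 3) := by
  have hη : 0 < P.mesh k := P.mesh_pos k
  have hηd : 0 < P.mesh k ^ P.d := pow_pos hη _
  set M : ℝ := (P.mesh k)⁻¹ + (1 + P.mesh k) ^ nbar * (1 + (P.mesh k)⁻¹ ^ 2) with hM
  have hb19 : ∀ b : HiggsLattice.PBond P k,
      P.mesh k ^ P.d * (‖sderiv Φ.2 b‖ * ‖Φ.2 b.src‖) * |Φ.1 b| ^ (nbar + 1) ≤ P.mesh k ^ P.d * (c0 P k * size Φ) ^ (nbar + 3) := by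
    intro b; rw [mul_assoc]
    exact mul_le_mul_of_nonneg_left (bond_term_le nbar Φ (norm_nonneg _) (abs_nonneg _) (norm_sderiv_le_size Φ b)
      (norm_phi_le_size Φ _) (abs_vec_le_size Φ b) le_rfl) hηd.le
  have hb111 : ∀ b : HiggsLattice.PBond P k,
      P.mesh k ^ P.d * ‖Φ.2 b.src‖ ^ 2 * |Φ.1 b| ^ (nbar + 1) ≤ P.mesh k ^ P.d * (c0 P k * size Φ) ^ (nbar + 3) := by
    intro b; rw [sq, mul_assoc]
    exact mul_le_mul_of_nonneg_left (bond_term_le nbar Φ (norm_nonneg _) (abs_nonneg _) (norm_phi_le_size Φ _)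
      (norm_phi_le_size Φ _) (abs_vec_le_size Φ b) le_rfl) hηd.le
  have hsum19 := Finset.sum_le_sum fun b (_ : b ∈ Finset.univ) => hb19 b
  have hsum111 := Finset.sum_le_sum fun b (_ : b ∈ Finset.univ) => hb111 b
  rw [Finset.sum_const, Finset.card_univ, nsmul_eq_mul] at hsum19 hsum111
  have hfinal : ∀ (pref : ℝ), 0 ≤ pref → pref ≤ M →
      pref * (Fintype.card (HiggsLattice.PBond P k) * (P.mesh k ^ P.d * (c0 P k * size Φ) ^ (nbar + 3)))
        ≤ vtxConst P k nbar * size Φ ^ (nbar + 3) := by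
    intro pref hp0 hp
    unfold vtxConst
    rw [mul_pow]
    have : 0 ≤ (Fintype.card (HiggsLattice.PBond P k) : ℝ) * (P.mesh k ^ P.d * (c0 P k ^ (nbar + 3) * size Φ ^ (nbar + 3))) := by
      have := one_le_c0 (P := P) (k := k); have := size_pos Φ; positivity
    calc pref * (Fintype.card (HiggsLattice.PBond P k) * (P.mesh k ^ P.d * (c0 P k ^ (nbar + 3) * size Φ ^ (nbar + 3))))
        ≤ M * (Fintype.card (HiggsLattice.PBond P k) * (P.mesh k ^ P.d * (c0 P k ^ (nbar + 3) * size Φ ^ (nbar + 3)))) :=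
          mul_le_mul_of_nonneg_right hp this
      _ = _ := by rw [hM]; ring
  constructor
  · unfold rhat19
    have hp0 : 0 ≤ P.mesh k ^ nbar / ((nbar + 1).factorial : ℝ) := by positivity
    have hp : P.mesh k ^ nbar / ((nbar + 1).factorial : ℝ) ≤ M := by
      have h := prefactor_le (P := P) (k := k) (nbar := nbar) (le_refl (nbar + 1)) _ (Or.inl rfl)
      rw [show ((nbar + 1 : ℕ) : ℤ) - 1 = (nbar : ℤ) by push_cast; ring, zpow_natCast] at h
      exact_mod_cast h
    exact (mul_le_mul_of_nonneg_left hsum19 hp0).trans (hfinal _ hp0 hp)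
  · unfold rhat111
    have hp0 : 0 ≤ P.mesh k ^ ((nbar : ℤ) - 1) / ((nbar + 1).factorial : ℝ) := by
      have := zpow_pos hη ((nbar : ℤ) - 1); positivity
    have hp : P.mesh k ^ ((nbar : ℤ) - 1) / ((nbar + 1).factorial : ℝ) ≤ M := by
      have h := prefactor_le (P := P) (k := k) (nbar := nbar) (le_refl (nbar + 1)) _ (Or.inr rfl)
      rw [show ((nbar + 1 : ℕ) : ℤ) - 2 = (nbar : ℤ) - 1 by push_cast; ring] at h
      exact_mod_cast h
    exact (mul_le_mul_of_nonneg_left hsum111 hp0).trans (hfinal _ hp0 hp)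

/-- Size of the scalar vertices: `|(1.6)| ≤ |λ|R`, `|(1.7)| ≤ ½|δm²||T|(1+η^d)·R`. [cite: Balaban1983Higgs3, (1.6)–(1.7) p.413] -/
theorem abs_vtx_scalar_le (C : HiggsLattice.ChargeData N) (lam dm2 : ℝ) (nbar : ℕ) (Φ : Cfg P k N) :
    |vtx C lam dm2 nbar (Sum.inl 0) Φ| ≤ |lam| * size Φ ^ (nbar + 3)
    ∧ |vtx C lam dm2 nbar (Sum.inl 1) Φ|
        ≤ |dm2| * (Fintype.card (HiggsLattice.Site P k) * (1 + P.mesh k ^ P.d)) * size Φ ^ (nbar + 3) := by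
  have hS := one_le_size Φ
  have hSp : size Φ ≤ size Φ ^ (nbar + 3) := le_self_pow₀ hS (by omega)
  have hq : quartic P k Φ.2 ≤ size Φ := by
    unfold size; have := sqVec_nonneg (P := P) (k := k) Φ.1; linarith
  have hq0 := quartic_nonneg (P := P) (k := k) Φ.2
  constructor
  · have e0 : vtx C lam dm2 nbar (Sum.inl 0) Φ = vertex16 lam Finset.univ Φ.2 := rfl
    rw [e0]
    unfold vertex16
    rw [abs_neg, abs_mul, show (∑ x, P.mesh k ^ P.d * ‖Φ.2 x‖ ^ 4) = quartic P k Φ.2 from rfl, abs_of_nonneg hq0]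
    exact mul_le_mul_of_nonneg_left (hq.trans hSp) (abs_nonneg _)
  · have e1 : vtx C lam dm2 nbar (Sum.inl 1) Φ = vertex17 (fun _ => dm2) 1 Finset.univ Φ.2 := rfl
    rw [e1]
    have h17 : vertex17 (fun _ => dm2) 1 Finset.univ Φ.2 = -(dm2 / 2) * sqMass P k Φ.2 := by
      unfold vertex17 sqMass
      rw [Finset.mul_sum, Finset.mul_sum]
      exact Finset.sum_congr rfl fun x _ => by ring
    rw [h17, abs_mul, abs_neg, abs_div, abs_two, abs_of_nonneg (sqMass_nonneg _)]
    have hm := sqMass_le_quartic (P := P) (k := k) Φ.2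
    have hcard : (0 : ℝ) ≤ Fintype.card (HiggsLattice.Site P k) * (1 + P.mesh k ^ P.d) := by
      have := pow_pos (P.mesh_pos k) P.d; positivity
    have h2 : (quartic P k Φ.2 + 1) ≤ 2 * size Φ ^ (nbar + 3) := by linarith
    calc |dm2| / 2 * sqMass P k Φ.2
        ≤ |dm2| / 2 * (Fintype.card (HiggsLattice.Site P k) * (1 + P.mesh k ^ P.d) * (quartic P k Φ.2 + 1)) :=
          mul_le_mul_of_nonneg_left hm (by positivity)
      _ ≤ |dm2| / 2 * (Fintype.card (HiggsLattice.Site P k) * (1 + P.mesh k ^ P.d) * (2 * size Φ ^ (nbar + 3))) :=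
          mul_le_mul_of_nonneg_left (mul_le_mul_of_nonneg_left h2 hcard) (by positivity)
      _ = _ := by ring

/-- **One constant for all vertex types at the charge `C`**: `|X_c(A,φ)| ≤ K·R(A,φ)^{n̄+3}` for every type `c`
(genuine: `|e|^{ord c}` times the unit-charge bound; R-vertices: `|e|^{n̄+1}` times `R̂`). [cite: Balaban1983Higgs3, (1.6)–(1.11) p.413] -/
noncomputable def allConst (P : HiggsLattice.Params) (k : ℕ) (C : HiggsLattice.ChargeData N) (lam dm2 : ℝ) (nbar : ℕ) : ℝ :=
  (1 + |C.e|) ^ (nbar + 1) * (|lam| + |dm2| * (Fintype.card (HiggsLattice.Site P k) * (1 + P.mesh k ^ P.d))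
    + 2 * vtxConst P k nbar)

/-- `K ≥ 0`. [cite: Balaban1983Higgs3, (1.6)–(1.11) p.413] -/
theorem allConst_nonneg (C : HiggsLattice.ChargeData N) (lam dm2 : ℝ) (nbar : ℕ) : 0 ≤ allConst P k C lam dm2 nbar := by
  unfold allConst
  have := vtxConst_nonneg (P := P) (k := k) nbar
  have := pow_pos (P.mesh_pos k) P.d
  positivity

/-- **Every vertex type has polynomial growth** `|X_c(A,φ)| ≤ K·R(A,φ)^{n̄+3}`. [cite: Balaban1983Higgs3, (1.6)–(1.11) p.413] -/
theorem abs_vtx_le (C : HiggsLattice.ChargeData N) (lam dm2 : ℝ) (nbar : ℕ) (c : VType nbar) (Φ : Cfg P k N) :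
    |vtx C lam dm2 nbar c Φ| ≤ allConst P k C lam dm2 nbar * size Φ ^ (nbar + 3) := by
  have hS : 0 ≤ size Φ ^ (nbar + 3) := pow_nonneg (size_pos Φ).le _
  have hV := vtxConst_nonneg (P := P) (k := k) nbar
  have hcard : (0 : ℝ) ≤ Fintype.card (HiggsLattice.Site P k) * (1 + P.mesh k ^ P.d) := by
    have := pow_pos (P.mesh_pos k) P.d; positivity
  set L : ℝ := |lam| + |dm2| * (Fintype.card (HiggsLattice.Site P k) * (1 + P.mesh k ^ P.d)) + 2 * vtxConst P k nbar
    with hL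
  have hL0 : 0 ≤ L := by positivity
  have he0 : 0 ≤ |C.e| := abs_nonneg _
  have hE1 : 1 ≤ (1 + |C.e|) ^ (nbar + 1) := one_le_pow₀ (by linarith)
  have hEpow : ∀ m ≤ nbar + 1, |C.e| ^ m ≤ (1 + |C.e|) ^ (nbar + 1) := fun m hm =>
    (pow_le_pow_left₀ he0 (by linarith) m).trans (pow_le_pow_right₀ (by linarith) hm)
  suffices h : |vtx C lam dm2 nbar c Φ| ≤ (1 + |C.e|) ^ (nbar + 1) * (L * size Φ ^ (nbar + 3)) by
    calc |vtx C lam dm2 nbar c Φ| ≤ (1 + |C.e|) ^ (nbar + 1) * (L * size Φ ^ (nbar + 3)) := h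
      _ = allConst P k C lam dm2 nbar * size Φ ^ (nbar + 3) := by rw [hL, allConst]; ring
  have hlift : ∀ {y : ℝ}, |vtx C lam dm2 nbar c Φ| ≤ y → y ≤ L * size Φ ^ (nbar + 3) →
      |vtx C lam dm2 nbar c Φ| ≤ (1 + |C.e|) ^ (nbar + 1) * (L * size Φ ^ (nbar + 3)) := fun h1 h2 =>
    (h1.trans h2).trans (le_mul_of_one_le_left (mul_nonneg hL0 hS) hE1)
  have hdm0 : 0 ≤ |dm2| * (Fintype.card (HiggsLattice.Site P k) * (1 + P.mesh k ^ P.d)) :=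
    mul_nonneg (abs_nonneg _) hcard
  have hLlam : |lam| ≤ L := by rw [hL]; linarith
  have hLdm : |dm2| * (Fintype.card (HiggsLattice.Site P k) * (1 + P.mesh k ^ P.d)) ≤ L := by
    rw [hL]; linarith [abs_nonneg lam]
  have hLV : 2 * vtxConst P k nbar ≤ L := by rw [hL]; linarith [abs_nonneg lam]
  rcases c with i | j | j
  · fin_cases i
    · exact hlift (abs_vtx_scalar_le C lam dm2 nbar Φ).1 (mul_le_mul_of_nonneg_right hLlam hS)
    · exact hlift (abs_vtx_scalar_le C lam dm2 nbar Φ).2 (mul_le_mul_of_nonneg_right hLdm hS)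
    · -- the R-vertices: `|e|^{n̄+1}(R̂₉ + R̂₁₁)`
      have h19 := abs_vertex19_le C nbar Φ
      have h111 := abs_vertex111_le C nbar Φ
      have hr := rhat_le (P := P) (k := k) (N := N) nbar Φ
      have e2 : vtx C lam dm2 nbar (Sum.inl 2) Φ = vertex19 C (fun _ => (1 : ℝ)) 0 0 Φ.1 Φ.2 nbar 0 Finset.univ
          + vertex111 C (fun _ => (1 : ℝ)) 0 Φ.1 Φ.2 nbar 0 Finset.univ := rfl
      have hR0 : 0 ≤ rhat19 P k nbar Φ + rhat111 P k nbar Φ := by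
        unfold rhat19 rhat111
        have := zpow_pos (P.mesh_pos k) ((nbar : ℤ) - 1); have := P.mesh_pos k; positivity
      have hsum : rhat19 P k nbar Φ + rhat111 P k nbar Φ ≤ L * size Φ ^ (nbar + 3) :=
        (add_le_add hr.1 hr.2).trans (by rw [← two_mul, ← mul_assoc]; exact mul_le_mul_of_nonneg_right hLV hS)
      calc |vtx C lam dm2 nbar (Sum.inl 2) Φ|
          ≤ |C.e| ^ (nbar + 1) * rhat19 P k nbar Φ + |C.e| ^ (nbar + 1) * rhat111 P k nbar Φ := by
            rw [e2]; exact (abs_add_le _ _).trans (add_le_add h19 h111)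
        _ = |C.e| ^ (nbar + 1) * (rhat19 P k nbar Φ + rhat111 P k nbar Φ) := by ring
        _ ≤ (1 + |C.e|) ^ (nbar + 1) * (L * size Φ ^ (nbar + 3)) :=
            mul_le_mul (hEpow _ le_rfl) hsum hR0 (zero_le_one.trans hE1)
  · -- (1.8)_{j+1,0}: `e^{j+1}` times the unit-charge vertex
    have hVL : vtxConst P k nbar * size Φ ^ (nbar + 3) ≤ L * size Φ ^ (nbar + 3) :=
      mul_le_mul_of_nonneg_right (by linarith) hS
    rw [vtx_eq_pow_mul_chargeOne C lam dm2 nbar (genuine_inr_inl nbar j), abs_mul, abs_pow]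
    exact mul_le_mul (hEpow _ (ord_le_succ nbar _)) ((abs_vtx_charged_le C lam dm2 nbar j Φ).1.trans hVL)
      (abs_nonneg _) (zero_le_one.trans hE1)
  · have hVL : vtxConst P k nbar * size Φ ^ (nbar + 3) ≤ L * size Φ ^ (nbar + 3) :=
      mul_le_mul_of_nonneg_right (by linarith) hS
    rw [vtx_eq_pow_mul_chargeOne C lam dm2 nbar (genuine_inr_inr nbar j), abs_mul, abs_pow]
    exact mul_le_mul (hEpow _ (ord_le_succ nbar _)) ((abs_vtx_charged_le C lam dm2 nbar j Φ).2.trans hVL)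
      (abs_nonneg _) (zero_le_one.trans hE1)

/-- At unit charge the same constant bounds the genuine vertices without any power of `e`. [cite: Balaban1983Higgs3, (1.6)–(1.10) p.413] -/
theorem abs_vtx_chargeOne_le (C : HiggsLattice.ChargeData N) (lam dm2 : ℝ) (nbar : ℕ) {c : VType nbar}
    (hc : Genuine nbar c) (Φ : Cfg P k N) :
    |vtx (chargeOne C) lam dm2 nbar c Φ|
      ≤ (|lam| + |dm2| * (Fintype.card (HiggsLattice.Site P k) * (1 + P.mesh k ^ P.d)) + 2 * vtxConst P k nbar)
          * size Φ ^ (nbar + 3) := by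
  have hS : 0 ≤ size Φ ^ (nbar + 3) := pow_nonneg (size_pos Φ).le _
  have hV := vtxConst_nonneg (P := P) (k := k) nbar
  have hcard : (0 : ℝ) ≤ Fintype.card (HiggsLattice.Site P k) * (1 + P.mesh k ^ P.d) := by
    have := pow_pos (P.mesh_pos k) P.d; positivity
  have hdm0 : 0 ≤ |dm2| * (Fintype.card (HiggsLattice.Site P k) * (1 + P.mesh k ^ P.d)) :=
    mul_nonneg (abs_nonneg _) hcard
  have hlam0 := abs_nonneg lam
  have lift : ∀ {y K : ℝ}, |vtx (chargeOne C) lam dm2 nbar c Φ| ≤ K * size Φ ^ (nbar + 3) →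
      K ≤ y → |vtx (chargeOne C) lam dm2 nbar c Φ| ≤ y * size Φ ^ (nbar + 3) := fun h1 h2 =>
    h1.trans (mul_le_mul_of_nonneg_right h2 hS)
  rcases c with i | j | j
  · fin_cases i
    · exact lift (abs_vtx_scalar_le (chargeOne C) lam dm2 nbar Φ).1 (by linarith)
    · exact lift (abs_vtx_scalar_le (chargeOne C) lam dm2 nbar Φ).2 (by linarith)
    · exact absurd hc (not_genuine_inl_two nbar)
  · exact lift (abs_vtx_charged_le C lam dm2 nbar j Φ).1 (by linarith)
  · exact lift (abs_vtx_charged_le C lam dm2 nbar j Φ).2 (by linarith)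

/-- `(A,φ) ↦ φ(x)` is continuous. [folklore] [cite: Balaban1983Higgs3, (1.6)–(1.11) p.413] -/
private theorem continuous_phi (x : HiggsLattice.Site P k) : Continuous fun Φ : Cfg P k N => Φ.2 x :=
  (continuous_apply x).comp continuous_snd

/-- `(A,φ) ↦ A_b` is continuous. [folklore] [cite: Balaban1983Higgs3, (1.6)–(1.11) p.413] -/
private theorem continuous_vec (b : HiggsLattice.PBond P k) : Continuous fun Φ : Cfg P k N => Φ.1 b :=
  (continuous_apply b).comp continuous_fst

/-- The (1.8) leg bracket at `B̃ = 0` is continuous in `(A,φ)`. [cite: Balaban1983Higgs3, (1.6)–(1.11) p.413] -/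
private theorem continuous_leg18 (C : HiggsLattice.ChargeData N) (T : B3Eq18VertexExpansion.Op N) (b : HiggsLattice.PBond P k) :
    Continuous fun Φ : Cfg P k N => leg18 C 0 Φ.2 T b := by
  unfold leg18
  exact ((continuous_covDeriv C b).comp (continuous_const.prodMk continuous_snd)).inner
    (T.continuous.comp (continuous_phi b.src))

/-- The (1.10) leg bracket is continuous in `(A,φ)`. [cite: Balaban1983Higgs3, (1.6)–(1.11) p.413] -/
private theorem continuous_leg110 (T : B3Eq18VertexExpansion.Op N) (b : HiggsLattice.PBond P k) :
    Continuous fun Φ : Cfg P k N => leg110 Φ.2 T b := by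
  unfold leg110
  exact (continuous_phi b.src).inner (T.continuous.comp (continuous_phi b.src))

/-- (1.6) is continuous in the configuration. [cite: Balaban1983Higgs3, (1.6) p.413] -/
theorem continuous_vertex16_cfg (lam : ℝ) : Continuous fun Φ : Cfg P k N => vertex16 lam Finset.univ Φ.2 := by
  unfold vertex16
  exact (continuous_const.mul (continuous_finsetSum _ fun x _ =>
    ((continuous_phi x).norm.pow 4).const_mul _)).neg

/-- (1.7) is continuous in the configuration. [cite: Balaban1983Higgs3, (1.7) p.413] -/
theorem continuous_vertex17_cfg (dm2 : ℝ) : Continuous fun Φ : Cfg P k N => vertex17 (fun _ => dm2) 1 Finset.univ Φ.2 := by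
  unfold vertex17
  exact continuous_const.mul (continuous_finsetSum _ fun x _ => ((continuous_phi x).norm.pow 2).const_mul _)

/-- (1.8)_{n,0} is continuous in the configuration `(A, φ)`. [cite: Balaban1983Higgs3, (1.8) p.413] -/
theorem continuous_vertex18_cfg (C : HiggsLattice.ChargeData N) (n : ℕ) :
    Continuous fun Φ : Cfg P k N => vertex18 C (fun _ => (1 : ℝ)) 0 Φ.1 0 Φ.2 n 0 Finset.univ := by
  unfold vertex18
  refine continuous_const.mul (continuous_finsetSum _ fun b _ => ?_)
  exact (((continuous_leg18 C _ b).const_mul _).mul ((continuous_const.mul (continuous_vec b)).pow _)).mul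
    continuous_const

/-- (1.10)_{n,0} is continuous in the configuration `(A, φ)`. [cite: Balaban1983Higgs3, (1.10) p.413] -/
theorem continuous_vertex110_cfg (C : HiggsLattice.ChargeData N) (n : ℕ) :
    Continuous fun Φ : Cfg P k N => vertex110 C (fun _ => (1 : ℝ)) Φ.1 0 Φ.2 n 0 Finset.univ := by
  unfold vertex110
  refine continuous_const.mul (continuous_finsetSum _ fun b _ => ?_)
  exact (((continuous_leg110 _ b).const_mul _).mul ((continuous_const.mul (continuous_vec b)).pow _)).mul
    continuous_const

/-- The genuine vertex types are continuous in the configuration. [cite: Balaban1983Higgs3, (1.6)–(1.10) p.413] -/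
theorem continuous_vtx_genuine (C : HiggsLattice.ChargeData N) (lam dm2 : ℝ) (nbar : ℕ) {c : VType nbar}
    (hc : Genuine nbar c) : Continuous fun Φ : Cfg P k N => vtx C lam dm2 nbar c Φ := by
  rcases c with i | j | j
  · fin_cases i
    · exact (continuous_vertex16_cfg lam).congr fun Φ => (vtx_inl_zero C lam dm2 nbar Φ).symm
    · exact (continuous_vertex17_cfg dm2).congr fun Φ => (vtx_inl_one C lam dm2 nbar Φ).symm
    · exact absurd hc (not_genuine_inl_two nbar)
  · exact (continuous_vertex18_cfg C _).congr fun Φ => (vtx_inr_inl C lam dm2 nbar j Φ).symm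
  · exact (continuous_vertex110_cfg C _).congr fun Φ => (vtx_inr_inr C lam dm2 nbar j Φ).symm

/-- The R-colour is minus the total vertex minus the genuine vertices (so it is continuous too).
[cite: Balaban1983Higgs3, (1.9)–(1.11) p.413] -/
theorem vtx_R_eq (C : HiggsLattice.ChargeData N) (lam dm2 : ℝ) (nbar : ℕ) (Φ : Cfg P k N) :
    vtx C lam dm2 nbar (Sum.inl 2) Φ
      = -totalVertex C lam dm2 Φ - (vtx C lam dm2 nbar (Sum.inl 0) Φ + vtx C lam dm2 nbar (Sum.inl 1) Φ
          + ∑ j : Fin nbar, vtx C lam dm2 nbar (Sum.inr (Sum.inl j)) Φ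
          + ∑ j : Fin nbar, vtx C lam dm2 nbar (Sum.inr (Sum.inr j)) Φ) := by
  have h := neg_totalVertex_eq_sum_vtx C lam dm2 nbar Φ
  rw [Fintype.sum_sum_type, Fintype.sum_sum_type, Fin.sum_univ_three] at h
  linarith

/-- **Every vertex type is continuous** in the configuration `(A, φ)` (hence measurable). [cite: Balaban1983Higgs3, (1.6)–(1.11) p.413] -/
theorem continuous_vtx (C : HiggsLattice.ChargeData N) (lam dm2 : ℝ) (nbar : ℕ) (c : VType nbar) :
    Continuous fun Φ : Cfg P k N => vtx C lam dm2 nbar c Φ := by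
  by_cases hc : Genuine nbar c
  · exact continuous_vtx_genuine C lam dm2 nbar hc
  · -- the only non-genuine colour is the R-colour `inl 2`
    obtain rfl := eq_inl_two_of_not_genuine hc
    simp_rw [vtx_R_eq]
    exact (continuous_totalVertex C lam dm2).neg.sub
      ((((continuous_vtx_genuine C lam dm2 nbar (genuine_inl_zero nbar)).add
        (continuous_vtx_genuine C lam dm2 nbar (genuine_inl_one nbar))).add
        (continuous_finsetSum _ fun j _ => continuous_vtx_genuine C lam dm2 nbar (genuine_inr_inl nbar j))).add
        (continuous_finsetSum _ fun j _ => continuous_vtx_genuine C lam dm2 nbar (genuine_inr_inr nbar j)))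

end Colours


/-! ## §2 The colouring expansion of the coefficients of a tilt by a SUM of vertices (abstract: any measure space) -/

section Colourings

open B3GaussianPerturbationGraphs (present mem_present prod_present_eq ursellOf_prod_mul)

variable {Ω : Type*} {κ : Type*} {F V : Ω → ℝ} {X : κ → Ω → ℝ} {n : ℕ}

/-! ### Pure combinatorics of the vertex family and of colour products -/

/-- The vertex family of the `n`-th coefficient: the pin `none` (the observable) and `n` vertices `some j`.
[cite: Mastropietro2008, §2.3 (2.38)] -/
def vfamily (n : ℕ) : Finset (Option (Fin n)) := insert none ((univ : Finset (Fin n)).map Function.Embedding.some)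

/-- The vertex family is nonempty (it contains the pin). [cite: Mastropietro2008, §2.3 (2.38)] -/
theorem vfamily_nonempty (n : ℕ) : (vfamily n).Nonempty := ⟨none, mem_insert_self _ _⟩

/-- Every vertex belongs to the vertex family. [cite: Mastropietro2008, §2.3 (2.38)] -/
theorem some_mem_vfamily (j : Fin n) : some j ∈ vfamily n :=
  mem_insert_of_mem (mem_map_of_mem _ (mem_univ j))

/-- All vertices are present in the full family. [cite: Mastropietro2008, §2.3 (2.38)] -/
theorem present_vfamily (n : ℕ) : present (vfamily n) = univ := by
  ext j
  simp only [mem_present, mem_univ, iff_true]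
  exact some_mem_vfamily j

/-- `(present P).map some = P.erase none`. [cite: Mastropietro2008, §2.3 (2.38)] -/
theorem map_present_eq_erase (P : Finset (Option (Fin n))) :
    (present P).map Function.Embedding.some = P.erase none := by
  ext x
  cases x with
  | none => simp
  | some j => simp [mem_present]

/-- `|present K| = |K| − 1` if the pin is in `K`. [cite: Mastropietro2008, §2.3 (2.38)] -/
theorem card_present_of_mem {P : Finset (Option (Fin n))} (h : none ∈ P) : (present P).card = P.card - 1 := by
  rw [← card_map Function.Embedding.some, map_present_eq_erase, card_erase_of_mem h]

/-- `|present K| = |K|` if the pin is not in `K`. [cite: Mastropietro2008, §2.3 (2.38)] -/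
theorem card_present_of_not_mem {P : Finset (Option (Fin n))} (h : none ∉ P) : (present P).card = P.card := by
  rw [← card_map Function.Embedding.some, map_present_eq_erase, erase_eq_of_notMem h]

/-- Expanding a product of sums of vertex values over the colourings (free on the vertices present, frozen at `z₀`
elsewhere). [cite: Balaban1983Higgs3, p.414] -/
theorem prod_present_sum_eq [Fintype κ] (x : κ → ℝ) (z₀ : Fin n → κ) (P : Finset (Option (Fin n))) :
    ∏ _j ∈ present P, (∑ c, x c)
      = ∑ z ∈ Fintype.piFinset (colours (fun _ => (univ : Finset κ)) z₀ P), ∏ j ∈ present P, x (z j) := by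
  have h1 : ∏ _j ∈ present P, (∑ c, x c)
      = ∏ j, ∑ c ∈ colours (fun _ => (univ : Finset κ)) z₀ P j, (if some j ∈ P then x c else 1) := by
    rw [present, prod_filter]
    refine prod_congr rfl fun j _ => ?_
    unfold colours
    split_ifs with hj
    · rfl
    · rw [sum_singleton]
  rw [h1, prod_univ_sum]
  refine sum_congr rfl fun z _ => ?_
  rw [present, prod_filter]

/-- `|[F]| = [|F|]`. [folklore] [cite: Balaban1983Higgs3, (1.21) p.416] -/
private theorem abs_obs_eq (K : Finset (Option (Fin n))) (σ : Ω) :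
    |(if none ∈ K then F σ else 1)| = (if none ∈ K then |F σ| else 1) := by
  split_ifs <;> simp

/-- `[|F|] ≥ 0`. [folklore] [cite: Balaban1983Higgs3, (1.21) p.416] -/
private theorem obs_nonneg (K : Finset (Option (Fin n))) (σ : Ω) : 0 ≤ (if none ∈ K then |F σ| else 1) := by
  split_ifs
  · exact abs_nonneg _
  · exact zero_le_one

/-- `|Π f| ≤ ρ·Π g` when `|f| ≤ g` termwise and `|f i₀| ≤ ρ g i₀` at one index. [folklore] [cite: Balaban1983Higgs3, (1.21) p.416] -/
theorem abs_prod_le_mul_prod {ι : Type*} [DecidableEq ι] (s : Finset ι) (f g : ι → ℝ) {ρ : ℝ} (hρ : 0 ≤ ρ)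
    (hfg : ∀ i ∈ s, |f i| ≤ g i) {i₀ : ι} (hi₀ : i₀ ∈ s) (h0 : |f i₀| ≤ ρ * g i₀) :
    |∏ i ∈ s, f i| ≤ ρ * ∏ i ∈ s, g i := by
  have hg : ∀ i ∈ s, 0 ≤ g i := fun i hi => (abs_nonneg _).trans (hfg i hi)
  rw [abs_prod, ← mul_prod_erase s _ hi₀, ← mul_prod_erase s g hi₀, ← mul_assoc]
  exact mul_le_mul h0 (prod_le_prod (fun i _ => abs_nonneg _) fun i hi => hfg i (mem_of_mem_erase hi))
    (prod_nonneg fun i _ => abs_nonneg _) (mul_nonneg hρ (hg _ hi₀))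

/-! ### The colour moments and the expansion -/

variable [MeasurableSpace Ω] {ν : Measure Ω}

/-- **The COLOUR MOMENT** of a colouring `z : Fin n → κ` of the vertices: on a block `K`,
`(∫ [F if the pin ∈ K] · Π_{j present in K} X_{z_j} dν) / Z`. [cite: Balaban1983Higgs3, (1.21) p.416]
[cite: Mastropietro2008, §2.3 (2.38)] -/
noncomputable def colourMoment (ν : Measure Ω) (F : Ω → ℝ) (X : κ → Ω → ℝ) (Z : ℝ) (z : Fin n → κ)
    (K : Finset (Option (Fin n))) : ℝ :=
  (∫ σ, (if none ∈ K then F σ else 1) * ∏ j ∈ present K, X (z j) σ ∂ν) / Z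

/-- Locality: the colour moment of `P` depends only on the colours of the vertices present in `P`.
[cite: Mastropietro2008, §2.3 (2.32)-(2.36)] -/
theorem colourMoment_congr {Z : ℝ} {P : Finset (Option (Fin n))} {z z' : Fin n → κ}
    (h : ∀ j, some j ∈ P → z j = z' j) : colourMoment ν F X Z z P = colourMoment ν F X Z z' P := by
  unfold colourMoment
  congr 1
  refine integral_congr_ae (Eventually.of_forall fun σ => ?_)
  dsimp only
  rw [prod_congr rfl fun j hj => by rw [h j (mem_present.1 hj)]]

/-- `N_k(0) = ∫ F(−V)^k dν`. [folklore] [cite: Balaban1983Higgs3, (1.21) p.416] -/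
theorem tiltMoment_zero (ν : Measure Ω) (F V : Ω → ℝ) (k : ℕ) :
    tiltMoment ν F V k 0 = ∫ σ, F σ * (-V σ) ^ k ∂ν := by
  unfold tiltMoment
  refine integral_congr_ae (Eventually.of_forall fun σ => ?_)
  simp

/-- `Z(0) = ν(Ω)`. [folklore] [cite: Balaban1983Higgs3, (1.19) p.416] -/
theorem tiltZ_zero (ν : Measure Ω) (V : Ω → ℝ) : tiltZ ν V 0 = ν.real Set.univ := by
  rw [tiltZ_eq_integral]
  simp [integral_const]

/-- **The pinned tilted moments at `t = 0` are colour sums** (`−V = Σ_c X_c`):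
`⟨F(−V)^{|K|−1}⟩ = Σ_z ⟨F Π_{j∈K} X_{z_j}⟩` etc. [cite: Balaban1983Higgs3, (1.21) p.416] [cite: Mastropietro2008, §2.3 (2.38)] -/
theorem pinnedMoments_zero_eq_sum [Fintype κ] (h : TiltData ν F V) (h1 : TiltData ν (fun _ => (1 : ℝ)) V)
    (hX : ∀ σ, ∑ c, X c σ = -V σ)
    (hI : ∀ (K : Finset (Option (Fin n))) (z : Fin n → κ),
      Integrable (fun σ => (if none ∈ K then F σ else 1) * ∏ j ∈ present K, X (z j) σ) ν)
    (z₀ : Fin n → κ) (K : Finset (Option (Fin n))) :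
    pinnedMoments none (tiltMoment ν F V 0) (tiltZ ν V) (Set.Ici 0) 0 K
      = ∑ z ∈ Fintype.piFinset (colours (fun _ => (univ : Finset κ)) z₀ K), colourMoment ν F X (tiltZ ν V 0) z K := by
  have key : ∀ G : Ω → ℝ, (∀ z : Fin n → κ, Integrable (fun σ => G σ * ∏ j ∈ present K, X (z j) σ) ν) →
      tiltMoment ν G V (present K).card 0
        = ∑ z ∈ Fintype.piFinset (colours (fun _ => (univ : Finset κ)) z₀ K),
            ∫ σ, G σ * ∏ j ∈ present K, X (z j) σ ∂ν := by
    intro G hG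
    rw [tiltMoment_zero, ← integral_finsetSum _ fun z _ => hG z]
    refine integral_congr_ae (Eventually.of_forall fun σ => ?_)
    dsimp only
    rw [← mul_sum, ← prod_present_sum_eq (fun c => X c σ) z₀ K, prod_const, hX σ]
  unfold colourMoment
  rw [h.pinnedMoments_eq h1 le_rfl, ← sum_div]
  split_ifs with hK
  · rw [← card_present_of_mem hK, key F fun z => by simpa [hK] using hI K z]
  · rw [← card_present_of_not_mem hK, key (fun _ => 1) fun z => by simpa [hK] using hI K z]

/-- **THE COLOURING EXPANSION OF THE COEFFICIENTS**: if `−V = Σ_{c ∈ κ} X_c` (finitely many vertex types, all moments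
finite), the `n`-th right derivative at `t = 0` of the tilted expectation `⟨Fe^{−tV}⟩/⟨e^{−tV}⟩` is the sum over the
COLOURINGS `z ∈ κ^n` of the vertices of the truncated expectation `⟨F; X_{z_1}; …; X_{z_n}⟩ᵀ_ν` (the Ursell function of
the colour moments) — «an arbitrary term of the expansion» is a choice of a vertex type for each vertex.
[cite: Balaban1983Higgs3, (1.21) p.416] [cite: Mastropietro2008, §2.3 (2.38)] -/
theorem iteratedDerivWithin_tiltExpect_zero_eq_sum [NeZero ν] [Fintype κ] [Nonempty κ] (h : TiltData ν F V)
    (h1 : TiltData ν (fun _ => (1 : ℝ)) V) (hX : ∀ σ, ∑ c, X c σ = -V σ)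
    (hI : ∀ (K : Finset (Option (Fin n))) (z : Fin n → κ),
      Integrable (fun σ => (if none ∈ K then F σ else 1) * ∏ j ∈ present K, X (z j) σ) ν) :
    iteratedDerivWithin n (tiltExpect ν F V) (Set.Ici 0) 0
      = ∑ z : Fin n → κ, ursellOf (colourMoment ν F X (tiltZ ν V 0) z) (vfamily n) := by
  set z₀ : Fin n → κ := fun _ => Classical.arbitrary κ
  rw [h.iteratedDerivWithin_tiltExpect_eq_ursellOf_fin h1 le_rfl n,
    show insert none ((univ : Finset (Fin n)).map Function.Embedding.some) = vfamily n from rfl,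
    ursellOf_piFinset (fun _ => (univ : Finset κ)) z₀ _ (fun z P => colourMoment ν F X (tiltZ ν V 0) z P)
      (fun _ _ _ hzz' => colourMoment_congr hzz') (fun P => pinnedMoments_zero_eq_sum h h1 hX hI z₀ P)
      (vfamily_nonempty n)]
  have hcol : colours (fun _ => (univ : Finset κ)) z₀ (vfamily n) = fun _ => univ := by
    funext j; unfold colours; rw [if_pos (some_mem_vfamily j)]
  rw [hcol, Fintype.piFinset_univ]

/-! ### Homogeneity in the vertex types and the size of the colourings using a small type -/

/-- Rescaling the vertex types, `X_c = a_c·X′_c` on the colours used, rescales the colour moment of `K` by `Π_{j∈K} a_{z_j}`.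
[cite: Mastropietro2008, §2.3 (2.32)-(2.36)] -/
theorem colourMoment_smul (a : κ → ℝ) {X X' : κ → Ω → ℝ} (Z : ℝ) {z : Fin n → κ}
    (hz : ∀ j σ, X (z j) σ = a (z j) * X' (z j) σ) (K : Finset (Option (Fin n))) :
    colourMoment ν F X Z z K = (∏ x ∈ K, x.elim 1 fun j => a (z j)) * colourMoment ν F X' Z z K := by
  unfold colourMoment
  have hfun : (fun σ => (if none ∈ K then F σ else 1) * ∏ j ∈ present K, X (z j) σ)
      = fun σ => (∏ j ∈ present K, a (z j)) * ((if none ∈ K then F σ else 1) * ∏ j ∈ present K, X' (z j) σ) := by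
    funext σ
    rw [prod_congr rfl fun j _ => hz j σ, prod_mul_distrib]
    ring
  rw [hfun, integral_const_mul, ← prod_present_eq, mul_div_assoc]

/-- **Homogeneity of the truncated coefficient of a colouring**: `⟨F; a_{z_1}X′_{z_1}; …⟩ᵀ = (Π_j a_{z_j})·⟨F; X′_{z_1}; …⟩ᵀ`.
[cite: Mastropietro2008, §2.3 (2.32)-(2.36)] -/
theorem ursellOf_colourMoment_smul (a : κ → ℝ) {X X' : κ → Ω → ℝ} (Z : ℝ) {z : Fin n → κ}
    (hz : ∀ j σ, X (z j) σ = a (z j) * X' (z j) σ) :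
    ursellOf (colourMoment ν F X Z z) (vfamily n) = (∏ j, a (z j)) * ursellOf (colourMoment ν F X' Z z) (vfamily n) := by
  have h1 : colourMoment ν F X Z z = fun P => (∏ x ∈ P, x.elim 1 fun j => a (z j)) * colourMoment ν F X' Z z P :=
    funext fun K => colourMoment_smul a Z hz K
  rw [h1, ursellOf_prod_mul _ _ (vfamily_nonempty n), ← prod_present_eq, present_vfamily]

/-- The MAJORANT MOMENT of a colouring: `(∫ [|F| if pin ∈ K] · Π_{j present} X̂_{z_j} dν) / Z` for majorants `X̂_c ≥ |X_c|`.
[cite: Balaban1983Higgs3, (1.9)/(1.11) p.413] -/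
noncomputable def hatMoment (ν : Measure Ω) (F : Ω → ℝ) (Xh : κ → Ω → ℝ) (Z : ℝ) (z : Fin n → κ)
    (K : Finset (Option (Fin n))) : ℝ :=
  (∫ σ, (if none ∈ K then |F σ| else 1) * ∏ j ∈ present K, Xh (z j) σ ∂ν) / Z

/-- The REMAINDER MAJORANT of a colouring: `Σ_{π ∈ 𝒫(vertex family)} (|π|−1)! Π_{K∈π} (majorant moment of K)` — the explicit
Möbius form of the truncation with absolute values. [cite: Balaban1983Higgs3, (1.21) p.416] [cite: Ruelle1969, §4.4.1 (4.6)] -/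
noncomputable def remBound (ν : Measure Ω) (F : Ω → ℝ) (Xh : κ → Ω → ℝ) (Z : ℝ) (z : Fin n → κ) : ℝ :=
  ∑ π ∈ setPartitions (vfamily n), ((π.card - 1).factorial : ℝ) * ∏ K ∈ π, hatMoment ν F Xh Z z K

/-- The colour moment is bounded by `ρ ×` the majorant moment under a pointwise product bound. [cite: Balaban1983Higgs3, (1.21) p.416] -/
private theorem abs_colourMoment_le_aux {Xh : κ → Ω → ℝ} {Z ρ : ℝ} (hZ : 0 < Z) {z : Fin n → κ}
    {K : Finset (Option (Fin n))}
    (hIh : Integrable (fun σ => (if none ∈ K then |F σ| else 1) * ∏ j ∈ present K, Xh (z j) σ) ν)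
    (hpt : ∀ σ, |∏ j ∈ present K, X (z j) σ| ≤ ρ * ∏ j ∈ present K, Xh (z j) σ) :
    |colourMoment ν F X Z z K| ≤ ρ * hatMoment ν F Xh Z z K := by
  unfold colourMoment hatMoment
  rw [abs_div, abs_of_pos hZ, ← mul_div_assoc]
  refine div_le_div_of_nonneg_right ?_ hZ.le
  rw [← integral_const_mul]
  have h := norm_integral_le_of_norm_le (hIh.const_mul ρ) (Eventually.of_forall fun σ => (?_ :
    ‖(if none ∈ K then F σ else 1) * ∏ j ∈ present K, X (z j) σ‖
      ≤ ρ * ((if none ∈ K then |F σ| else 1) * ∏ j ∈ present K, Xh (z j) σ)))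
  · rwa [Real.norm_eq_abs] at h
  · rw [Real.norm_eq_abs, abs_mul, abs_obs_eq]
    calc (if none ∈ K then |F σ| else 1) * |∏ j ∈ present K, X (z j) σ|
        ≤ (if none ∈ K then |F σ| else 1) * (ρ * ∏ j ∈ present K, Xh (z j) σ) :=
          mul_le_mul_of_nonneg_left (hpt σ) (obs_nonneg K σ)
      _ = _ := by ring

/-- Every colour moment is bounded by its majorant moment (`|X_c| ≤ X̂_c`). [cite: Balaban1983Higgs3, (1.21) p.416] -/
theorem abs_colourMoment_le {Xh : κ → Ω → ℝ} {Z : ℝ} (hZ : 0 < Z) (hXh : ∀ c σ, |X c σ| ≤ Xh c σ)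
    {z : Fin n → κ} {K : Finset (Option (Fin n))}
    (hIh : Integrable (fun σ => (if none ∈ K then |F σ| else 1) * ∏ j ∈ present K, Xh (z j) σ) ν) :
    |colourMoment ν F X Z z K| ≤ hatMoment ν F Xh Z z K := by
  have h := abs_colourMoment_le_aux (X := X) (ρ := 1) hZ hIh fun σ => by
    rw [one_mul, abs_prod]
    exact prod_le_prod (fun _ _ => abs_nonneg _) fun _ _ => hXh _ _
  rwa [one_mul] at h

/-- A block containing a vertex of a SMALL type (`|X_c| ≤ ρX̂_c`) has colour moment `≤ ρ ×` its majorant.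
[cite: Balaban1983Higgs3, (1.9)/(1.11) p.413] -/
theorem abs_colourMoment_le_mul {Xh : κ → Ω → ℝ} {Z ρ : ℝ} (hZ : 0 < Z) (hρ : 0 ≤ ρ)
    (hXh : ∀ c σ, |X c σ| ≤ Xh c σ) {z : Fin n → κ} {K : Finset (Option (Fin n))}
    (hIh : Integrable (fun σ => (if none ∈ K then |F σ| else 1) * ∏ j ∈ present K, Xh (z j) σ) ν)
    {j₀ : Fin n} (hj₀ : some j₀ ∈ K) (hsmall : ∀ σ, |X (z j₀) σ| ≤ ρ * Xh (z j₀) σ) :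
    |colourMoment ν F X Z z K| ≤ ρ * hatMoment ν F Xh Z z K :=
  abs_colourMoment_le_aux hZ hIh fun σ =>
    abs_prod_le_mul_prod _ (fun j => X (z j) σ) (fun j => Xh (z j) σ) hρ (fun _ _ => hXh _ _)
      (mem_present.2 hj₀) (hsmall σ)

/-- Majorant moments are nonnegative. [cite: Balaban1983Higgs3, (1.21) p.416] -/
theorem hatMoment_nonneg {Xh : κ → Ω → ℝ} {Z : ℝ} (hZ : 0 < Z) (hXh : ∀ c σ, 0 ≤ Xh c σ) (z : Fin n → κ)
    (K : Finset (Option (Fin n))) : 0 ≤ hatMoment ν F Xh Z z K :=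
  div_nonneg (integral_nonneg fun σ => mul_nonneg (obs_nonneg K σ) (prod_nonneg fun _ _ => hXh _ _)) hZ.le

/-- The remainder majorant is nonnegative. [cite: Balaban1983Higgs3, (1.21) p.416] -/
theorem remBound_nonneg {Xh : κ → Ω → ℝ} {Z : ℝ} (hZ : 0 < Z) (hXh : ∀ c σ, 0 ≤ Xh c σ) (z : Fin n → κ) :
    0 ≤ remBound ν F Xh Z z :=
  sum_nonneg fun _ _ => mul_nonneg (Nat.cast_nonneg _) (prod_nonneg fun K _ => hatMoment_nonneg hZ hXh z K)

/-- The colour moment of the empty block is `1` (`Z = ν(Ω)`). [folklore] [cite: Balaban1983Higgs3, (1.21) p.416] -/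
theorem colourMoment_empty {Z : ℝ} (hZ : 0 < Z) (hZ1 : ν.real Set.univ = Z) (z : Fin n → κ) :
    colourMoment ν F X Z z ∅ = 1 := by
  unfold colourMoment
  have hp : present (∅ : Finset (Option (Fin n))) = ∅ := by ext j; simp [mem_present]
  rw [hp]
  simp only [Finset.notMem_empty, if_false, prod_empty, mul_one]
  rw [integral_const, smul_eq_mul, mul_one, hZ1, div_self hZ.ne']

/-- **A COLOURING USING A SMALL VERTEX TYPE HAS A SMALL TRUNCATED COEFFICIENT**: if `|X_c| ≤ X̂_c` for all types and
`|X_c| ≤ ρX̂_c` (`0 ≤ ρ ≤ 1`) for the types outside `G`, then for every colouring `z` using a type outside `G`,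
`|⟨F; X_{z_1}; …; X_{z_n}⟩ᵀ| ≤ ρ · Σ_π (|π|−1)! Π_{K∈π} (majorant moment)` — in each term of the Möbius form exactly the block
containing that vertex carries the factor `ρ`. [cite: Balaban1983Higgs3, (1.21) p.416] [cite: Ruelle1969, §4.4.1 (4.6)] -/
theorem abs_ursellOf_colourMoment_le {Xh : κ → Ω → ℝ} {Z ρ : ℝ} (hZ : 0 < Z) (hZ1 : ν.real Set.univ = Z)
    (hρ0 : 0 ≤ ρ) (hXh : ∀ c σ, |X c σ| ≤ Xh c σ) (G : κ → Prop)
    (hR : ∀ c, ¬ G c → ∀ σ, |X c σ| ≤ ρ * Xh c σ) {z : Fin n → κ}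
    (hIh : ∀ K : Finset (Option (Fin n)),
      Integrable (fun σ => (if none ∈ K then |F σ| else 1) * ∏ j ∈ present K, Xh (z j) σ) ν)
    {j₀ : Fin n} (hj₀ : ¬ G (z j₀)) :
    |ursellOf (colourMoment ν F X Z z) (vfamily n)| ≤ ρ * remBound ν F Xh Z z := by
  have hXh0 : ∀ c σ, 0 ≤ Xh c σ := fun c σ => (abs_nonneg _).trans (hXh c σ)
  have hall : ∀ K, |colourMoment ν F X Z z K| ≤ hatMoment ν F Xh Z z K := fun K =>
    abs_colourMoment_le hZ hXh (hIh K)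
  rw [ursellOf_eq_sum_setPartitions _ (colourMoment_empty hZ hZ1 z) (vfamily_nonempty n), remBound, mul_sum]
  refine (abs_sum_le_sum_abs _ _).trans (sum_le_sum fun π hπ => ?_)
  have hsp := mem_setPartitions.1 hπ
  obtain ⟨K₀, hK₀, hjK₀⟩ := hsp.exists_mem (some_mem_vfamily j₀)
  have hprod : ∏ K ∈ π, |colourMoment ν F X Z z K| ≤ ρ * ∏ K ∈ π, hatMoment ν F Xh Z z K := by
    rw [← mul_prod_erase π _ hK₀, ← mul_prod_erase π (hatMoment ν F Xh Z z) hK₀, ← mul_assoc]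
    exact mul_le_mul (abs_colourMoment_le_mul hZ hρ0 hXh (hIh K₀) hjK₀ (hR _ hj₀))
      (prod_le_prod (fun K _ => abs_nonneg _) fun K _ => hall K) (prod_nonneg fun K _ => abs_nonneg _)
      (mul_nonneg hρ0 (hatMoment_nonneg hZ hXh0 z K₀))
  rw [abs_mul, abs_mul, abs_pow, abs_neg, abs_one, one_pow, one_mul, Nat.abs_cast, abs_prod]
  calc ((π.card - 1).factorial : ℝ) * ∏ K ∈ π, |colourMoment ν F X Z z K|
      ≤ ((π.card - 1).factorial : ℝ) * (ρ * ∏ K ∈ π, hatMoment ν F Xh Z z K) :=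
        mul_le_mul_of_nonneg_left hprod (Nat.cast_nonneg _)
    _ = _ := by ring

end Colourings


/-! ## §3 The (1.19) instance: genuine colourings carry `e^{Σ ord}`, colourings with an R-vertex are `O(e^{n̄+1})` -/

section Application

open HiggsLattice HiggsActionIntegrable B1Sect1Statements B3Sect1TwoPoint
open B1Eq113OneSidedDerivatives (quartic quartic_nonneg continuous_quartic)
open B3GaussianPerturbationGraphs (present mem_present)

variable {P : HiggsLattice.Params} {k N : ℕ}

/-! ### The majorants `X̂_c` of the vertex types -/

/-- The MAJORANT of a vertex type: `|X_c|` itself for a genuine type, the charge-free `R̂₉ + R̂₁₁` for the R-colour.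
[cite: Balaban1983Higgs3, (1.9)/(1.11) p.413] -/
noncomputable def xhat (C : HiggsLattice.ChargeData N) (lam dm2 : ℝ) (nbar : ℕ) (c : VType nbar) (Φ : Cfg P k N) : ℝ :=
  if Genuine nbar c then |vtx C lam dm2 nbar c Φ| else rhat19 P k nbar Φ + rhat111 P k nbar Φ

/-- `R̂₉, R̂₁₁ ≥ 0`. [cite: Balaban1983Higgs3, (1.6)–(1.11) p.413] -/
theorem rhat_nonneg (nbar : ℕ) (Φ : Cfg P k N) : 0 ≤ rhat19 P k nbar Φ ∧ 0 ≤ rhat111 P k nbar Φ := by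
  unfold rhat19 rhat111
  have := zpow_pos (P.mesh_pos k) ((nbar : ℤ) - 1)
  have := P.mesh_pos k
  constructor <;> positivity

/-- `X̂_c ≥ 0`. [cite: Balaban1983Higgs3, (1.6)–(1.11) p.413] -/
theorem xhat_nonneg (C : HiggsLattice.ChargeData N) (lam dm2 : ℝ) (nbar : ℕ) (c : VType nbar) (Φ : Cfg P k N) :
    0 ≤ xhat C lam dm2 nbar c Φ := by
  unfold xhat
  split_ifs
  · exact abs_nonneg _
  · have h := rhat_nonneg (P := P) (k := k) (N := N) nbar Φ; exact add_nonneg h.1 h.2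

/-- **`|X_c(e)| ≤ X̂_c` for `|e| ≤ 1`** (genuine: `|e|^{ord c}|X_c(1)| ≤ |X_c(1)|`; R-colour: `|e|^{n̄+1}(R̂₉+R̂₁₁) ≤ R̂₉+R̂₁₁`).
[cite: Balaban1983Higgs3, (1.8)–(1.11) p.413] -/
theorem abs_vtx_le_xhat (C : HiggsLattice.ChargeData N) (lam dm2 : ℝ) (nbar : ℕ) (he : |C.e| ≤ 1) (c : VType nbar)
    (Φ : Cfg P k N) : |vtx C lam dm2 nbar c Φ| ≤ xhat (chargeOne C) lam dm2 nbar c Φ := by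
  unfold xhat
  split_ifs with hc
  · rw [vtx_eq_pow_mul_chargeOne C lam dm2 nbar hc, abs_mul, abs_pow]
    exact (mul_le_mul_of_nonneg_right (pow_le_one₀ (abs_nonneg _) he) (abs_nonneg _)).trans_eq (one_mul _)
  · obtain rfl := eq_inl_two_of_not_genuine hc
    have hR := rhat_nonneg (P := P) (k := k) (N := N) nbar Φ
    have hE : |C.e| ^ (nbar + 1) ≤ 1 := pow_le_one₀ (abs_nonneg _) he
    calc |vtx C lam dm2 nbar (Sum.inl 2) Φ|
        ≤ |C.e| ^ (nbar + 1) * rhat19 P k nbar Φ + |C.e| ^ (nbar + 1) * rhat111 P k nbar Φ := by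
          rw [vtx_inl_two]; exact (abs_add_le _ _).trans (add_le_add (abs_vertex19_le C nbar Φ) (abs_vertex111_le C nbar Φ))
      _ ≤ 1 * rhat19 P k nbar Φ + 1 * rhat111 P k nbar Φ :=
          add_le_add (mul_le_mul_of_nonneg_right hE hR.1) (mul_le_mul_of_nonneg_right hE hR.2)
      _ = _ := by ring

/-- **The R-colour is `O(e^{n̄+1})`**: `|X_R(e)| ≤ |e|^{n̄+1}·X̂_R`. [cite: Balaban1983Higgs3, (1.9)/(1.11) p.413] -/
theorem abs_vtx_le_pow_mul_xhat (C : HiggsLattice.ChargeData N) (lam dm2 : ℝ) (nbar : ℕ) {c : VType nbar}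
    (hc : ¬ Genuine nbar c) (Φ : Cfg P k N) :
    |vtx C lam dm2 nbar c Φ| ≤ |C.e| ^ (nbar + 1) * xhat (chargeOne C) lam dm2 nbar c Φ := by
  obtain rfl := eq_inl_two_of_not_genuine hc
  unfold xhat
  rw [if_neg hc, vtx_inl_two, mul_add]
  exact (abs_add_le _ _).trans (add_le_add (abs_vertex19_le C nbar Φ) (abs_vertex111_le C nbar Φ))

/-- The majorants have polynomial growth `X̂_c ≤ K·R^{n̄+3}`. [cite: Balaban1983Higgs3, (1.6)–(1.11) p.413] -/
theorem xhat_le (C : HiggsLattice.ChargeData N) (lam dm2 : ℝ) (nbar : ℕ) (c : VType nbar) (Φ : Cfg P k N) :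
    xhat C lam dm2 nbar c Φ ≤ (allConst P k C lam dm2 nbar + 2 * vtxConst P k nbar) * size Φ ^ (nbar + 3) := by
  have hS : 0 ≤ size Φ ^ (nbar + 3) := pow_nonneg (size_pos Φ).le _
  have hA := allConst_nonneg (P := P) (k := k) C lam dm2 nbar
  have hV := vtxConst_nonneg (P := P) (k := k) nbar
  unfold xhat
  split_ifs
  · exact (abs_vtx_le C lam dm2 nbar c Φ).trans (mul_le_mul_of_nonneg_right (by linarith) hS)
  · have hr := rhat_le (P := P) (k := k) (N := N) nbar Φ
    calc rhat19 P k nbar Φ + rhat111 P k nbar Φ ≤ 2 * vtxConst P k nbar * size Φ ^ (nbar + 3) := by linarith [hr.1, hr.2]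
      _ ≤ _ := mul_le_mul_of_nonneg_right (by linarith) hS

/-- `(A,φ) ↦ (∂^ηφ)(b)` is continuous. [folklore] [cite: Balaban1983Higgs3, (1.6)–(1.11) p.413] -/
private theorem continuous_sderiv_cfg (b : HiggsLattice.PBond P k) : Continuous fun Φ : Cfg P k N => sderiv Φ.2 b := by
  unfold sderiv
  exact ((continuous_phi (P := P) (k := k) (N := N) b.tgt).sub (continuous_phi b.src)).const_smul ((P.mesh k)⁻¹ : ℝ)

/-- `R̂₉` is continuous in `(A,φ)`. [cite: Balaban1983Higgs3, (1.6)–(1.11) p.413] -/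
theorem continuous_rhat19 (nbar : ℕ) : Continuous fun Φ : Cfg P k N => rhat19 P k nbar Φ := by
  unfold rhat19
  refine continuous_const.mul (continuous_finsetSum _ fun b _ => ?_)
  exact ((((continuous_sderiv_cfg b).norm.mul (continuous_phi b.src).norm).const_mul _).mul
    ((continuous_vec b).abs.pow _))

/-- `R̂₁₁` is continuous in `(A,φ)`. [cite: Balaban1983Higgs3, (1.6)–(1.11) p.413] -/
theorem continuous_rhat111 (nbar : ℕ) : Continuous fun Φ : Cfg P k N => rhat111 P k nbar Φ := by
  unfold rhat111
  refine continuous_const.mul (continuous_finsetSum _ fun b _ => ?_)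
  exact ((((continuous_phi b.src).norm.pow 2).const_mul _).mul ((continuous_vec b).abs.pow _))

/-- The majorants are continuous. [cite: Balaban1983Higgs3, (1.6)–(1.11) p.413] -/
theorem continuous_xhat (C : HiggsLattice.ChargeData N) (lam dm2 : ℝ) (nbar : ℕ) (c : VType nbar) :
    Continuous fun Φ : Cfg P k N => xhat C lam dm2 nbar c Φ := by
  unfold xhat
  split_ifs
  · exact (continuous_vtx C lam dm2 nbar c).abs
  · exact (continuous_rhat19 nbar).add (continuous_rhat111 nbar)

/-! ### Integrability of the colour products against `ν⁰` -/

/-- An observable of polynomial growth times a product of vertices of polynomial growth is `ν⁰`-integrable.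
[cite: Balaban1983Higgs3, (1.19) p.416] -/
theorem integrable_obs_mul_prod {msq mu0sq : ℝ} (hm : 0 < msq) (hmu : 0 < mu0sq) (C₀ : HiggsLattice.ChargeData N)
    {G : Cfg P k N → ℝ} (hG : Continuous G) {cG : ℝ} {q : ℕ} (hGb : ∀ Φ, |G Φ| ≤ cG * size Φ ^ q)
    {ι : Type*} (T : Finset ι) {Y : ι → Cfg P k N → ℝ} (hY : ∀ i ∈ T, Continuous (Y i)) {A : ℝ} {p : ℕ}
    (hYb : ∀ i ∈ T, ∀ Φ, |Y i Φ| ≤ A * size Φ ^ p) :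
    Integrable (fun Φ => G Φ * ∏ i ∈ T, Y i Φ) (freeMeasure P k N C₀ msq mu0sq) := by
  refine integrable_freeMeasure_of_le_size_pow hm hmu C₀ (hG.mul (continuous_finsetProd T hY))
    (K := cG * A ^ T.card) (n := q + p * T.card) fun Φ => ?_
  have hprod : |∏ i ∈ T, Y i Φ| ≤ A ^ T.card * size Φ ^ (p * T.card) := by
    rw [abs_prod]
    calc ∏ i ∈ T, |Y i Φ| ≤ ∏ _i ∈ T, A * size Φ ^ p := prod_le_prod (fun i _ => abs_nonneg _) fun i hi => hYb i hi Φ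
      _ = A ^ T.card * size Φ ^ (p * T.card) := by rw [prod_const, mul_pow, ← pow_mul]
  rw [abs_mul]
  calc |G Φ| * |∏ i ∈ T, Y i Φ| ≤ (cG * size Φ ^ q) * (A ^ T.card * size Φ ^ (p * T.card)) :=
        mul_le_mul (hGb Φ) hprod (abs_nonneg _) ((abs_nonneg _).trans (hGb Φ))
    _ = cG * A ^ T.card * size Φ ^ (q + p * T.card) := by ring

/-- An observable bound of BRICK 4's shape `|F| ≤ K(V₄+1)ⁿ` is a size bound `|F| ≤ |K|Rⁿ`. [cite: Balaban1983Higgs3, (1.19) p.416] -/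
theorem abs_le_size_pow_of_quartic {F : Cfg P k N → ℝ} {K₀ : ℝ} {n₀ : ℕ}
    (hb : ∀ Φ, |F Φ| ≤ K₀ * (quartic P k Φ.2 + 1) ^ n₀) (Φ : Cfg P k N) : |F Φ| ≤ |K₀| * size Φ ^ n₀ := by
  have hq : quartic P k Φ.2 + 1 ≤ size Φ := by
    unfold size; have := sqVec_nonneg (P := P) (k := k) Φ.1; linarith
  have hq0 : 0 ≤ quartic P k Φ.2 + 1 := by have := quartic_nonneg (P := P) (k := k) Φ.2; linarith
  calc |F Φ| ≤ K₀ * (quartic P k Φ.2 + 1) ^ n₀ := hb Φ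
    _ ≤ |K₀| * (quartic P k Φ.2 + 1) ^ n₀ := mul_le_mul_of_nonneg_right (le_abs_self _) (pow_nonneg hq0 _)
    _ ≤ |K₀| * size Φ ^ n₀ := mul_le_mul_of_nonneg_left (pow_le_pow_left₀ hq0 hq _) (abs_nonneg _)

/-- **The colour products `[F]·Π_j X_{z_j}` are `ν⁰`-integrable** (hypothesis `hI` of §2). [cite: Balaban1983Higgs3, (1.21) p.416] -/
theorem integrable_colourProduct {msq mu0sq : ℝ} (hm : 0 < msq) (hmu : 0 < mu0sq) (C : HiggsLattice.ChargeData N)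
    (lam dm2 : ℝ) (nbar : ℕ) {F : Cfg P k N → ℝ} (hF : Continuous F) {K₀ : ℝ} {n₀ : ℕ}
    (hb : ∀ Φ, |F Φ| ≤ K₀ * (quartic P k Φ.2 + 1) ^ n₀) {n : ℕ} (K : Finset (Option (Fin n)))
    (z : Fin n → VType nbar) :
    Integrable (fun Φ => (if none ∈ K then F Φ else 1) * ∏ j ∈ present K, vtx C lam dm2 nbar (z j) Φ)
      (freeMeasure P k N (chargeZero C) msq mu0sq) := by
  by_cases hK : none ∈ K
  · simp only [hK, if_true]
    exact integrable_obs_mul_prod hm hmu _ hF (abs_le_size_pow_of_quartic hb) (present K)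
      (fun j _ => continuous_vtx C lam dm2 nbar (z j)) fun j _ Φ => abs_vtx_le C lam dm2 nbar (z j) Φ
  · simp only [hK, if_false]
    exact integrable_obs_mul_prod hm hmu _ continuous_const (cG := 1) (q := 0) (fun Φ => by simp) (present K)
      (fun j _ => continuous_vtx C lam dm2 nbar (z j)) fun j _ Φ => abs_vtx_le C lam dm2 nbar (z j) Φ

/-- **The majorant products `[|F|]·Π_j X̂_{z_j}` are `ν⁰`-integrable** (hypothesis `hIh` of §2). [cite: Balaban1983Higgs3, (1.21) p.416] -/
theorem integrable_hatProduct {msq mu0sq : ℝ} (hm : 0 < msq) (hmu : 0 < mu0sq) (C C₁ : HiggsLattice.ChargeData N)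
    (lam dm2 : ℝ) (nbar : ℕ) {F : Cfg P k N → ℝ} (hF : Continuous F) {K₀ : ℝ} {n₀ : ℕ}
    (hb : ∀ Φ, |F Φ| ≤ K₀ * (quartic P k Φ.2 + 1) ^ n₀) {n : ℕ} (K : Finset (Option (Fin n)))
    (z : Fin n → VType nbar) :
    Integrable (fun Φ => (if none ∈ K then |F Φ| else 1) * ∏ j ∈ present K, xhat C₁ lam dm2 nbar (z j) Φ)
      (freeMeasure P k N (chargeZero C) msq mu0sq) := by
  have hxb : ∀ j ∈ present K, ∀ Φ : Cfg P k N, |xhat C₁ lam dm2 nbar (z j) Φ|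
      ≤ (allConst P k C₁ lam dm2 nbar + 2 * vtxConst P k nbar) * size Φ ^ (nbar + 3) := fun j _ Φ => by
    rw [abs_of_nonneg (xhat_nonneg C₁ lam dm2 nbar (z j) Φ)]; exact xhat_le C₁ lam dm2 nbar (z j) Φ
  by_cases hK : none ∈ K
  · simp only [hK, if_true]
    exact integrable_obs_mul_prod hm hmu _ hF.abs (fun Φ => by rw [abs_abs]; exact abs_le_size_pow_of_quartic hb Φ)
      (present K) (fun j _ => continuous_xhat C₁ lam dm2 nbar (z j)) hxb
  · simp only [hK, if_false]
    exact integrable_obs_mul_prod hm hmu _ continuous_const (cG := 1) (q := 0) (fun Φ => by simp) (present K)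
      (fun j _ => continuous_xhat C₁ lam dm2 nbar (z j)) hxb

/-! ### The coefficients of the colourings and the headline theorems -/

/-- **The truncated coefficient of a colouring** `z ∈ (vertex types)^n` at charge datum `C`:
`X_z := ⟨F; X_{z_1}; …; X_{z_n}⟩ᵀ_{ν⁰}` (normalized by `ν⁰(Ω)`), `ν⁰` the `e = 0` massive Gaussian of BOTH fields.
[cite: Balaban1983Higgs3, (1.21) p.416] -/
noncomputable def coefX (C : HiggsLattice.ChargeData N) (lam msq mu0sq dm2 : ℝ) (F : Cfg P k N → ℝ) (nbar : ℕ)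
    {n : ℕ} (z : Fin n → VType nbar) : ℝ :=
  ursellOf (colourMoment (freeMeasure P k N (chargeZero C) msq mu0sq) F (vtx C lam dm2 nbar)
    ((freeMeasure P k N (chargeZero C) msq mu0sq).real Set.univ) z) (vfamily n)

/-- **The remainder majorant of a colouring** (charge-free: built from `X̂` at unit charge, `|F|` and `ν⁰`).
[cite: Balaban1983Higgs3, (1.21) p.416] -/
noncomputable def coefR (C : HiggsLattice.ChargeData N) (lam msq mu0sq dm2 : ℝ) (F : Cfg P k N → ℝ) (nbar : ℕ)
    {n : ℕ} (z : Fin n → VType nbar) : ℝ :=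
  remBound (freeMeasure P k N (chargeZero C) msq mu0sq) F (xhat (chargeOne C) lam dm2 nbar)
    ((freeMeasure P k N (chargeZero C) msq mu0sq).real Set.univ) z

/-- The unit-charge coefficients `U_z := X_z(e := 1)` do not depend on the charge `e` (only on `q`, the masses, `λ` and the
value of `δm²`). [cite: Balaban1983Higgs3, (1.21) p.416] -/
theorem coefX_chargeOne_eq (C : HiggsLattice.ChargeData N) (e' : ℝ) (lam msq mu0sq dm2 : ℝ) (F : Cfg P k N → ℝ)
    (nbar : ℕ) {n : ℕ} (z : Fin n → VType nbar) :
    coefX (chargeOne { C with e := e' }) lam msq mu0sq dm2 F nbar z = coefX (chargeOne C) lam msq mu0sq dm2 F nbar z := rfl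

/-- The remainder majorants do not depend on the charge `e`. [cite: Balaban1983Higgs3, (1.21) p.416] -/
theorem coefR_eq (C : HiggsLattice.ChargeData N) (e' : ℝ) (lam msq mu0sq dm2 : ℝ) (F : Cfg P k N → ℝ)
    (nbar : ℕ) {n : ℕ} (z : Fin n → VType nbar) :
    coefR { C with e := e' } lam msq mu0sq dm2 F nbar z = coefR C lam msq mu0sq dm2 F nbar z := rfl

/-- `R_z ≥ 0`. [cite: Balaban1983Higgs3, (1.21) p.416] -/
theorem coefR_nonneg {msq mu0sq lam : ℝ} (hm : 0 < msq) (hmu : 0 < mu0sq) (hlam : 0 < lam)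
    (C : HiggsLattice.ChargeData N) (dm2 : ℝ) (F : Cfg P k N → ℝ) (nbar : ℕ) {n : ℕ} (z : Fin n → VType nbar) :
    0 ≤ coefR C lam msq mu0sq dm2 F nbar z := by
  haveI := freeMeasure_neZero (P := P) (k := k) (N := N) (chargeZero C) msq hmu
  have hZ : 0 < (freeMeasure P k N (chargeZero C) msq mu0sq).real Set.univ := by
    rw [← tiltZ_zero _ (totalVertex C lam dm2)]
    exact (tiltData_free_totalVertex_one hm hmu hlam C dm2).tiltZ_pos le_rfl
  exact remBound_nonneg hZ (fun c Φ => xhat_nonneg _ lam dm2 nbar c Φ) z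

/-- **THE COEFFICIENTS OF THE TOTAL-VERTEX EXPANSION ARE SUMS OVER THE ASSIGNMENTS OF VERTEX TYPES**: for the `e = 0`
Gaussian `ν⁰`, the total vertex `𝒱(e)` at charge datum `C` and ANY continuous observable of polynomial growth,
`(d/dt)^n ⟨Fe^{−t𝒱}⟩_{ν⁰}/⟨e^{−t𝒱}⟩_{ν⁰} |_{t=0⁺} = Σ_{z ∈ (types)^n} ⟨F; X_{z_1}; …; X_{z_n}⟩ᵀ_{ν⁰}`, the types being
(1.6), (1.7), (1.8)_{j,0}, (1.10)_{j,0} (`1 ≤ j ≤ n̄`) and the R-colour (1.9)_{n̄}+(1.11)_{n̄}.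
[cite: Balaban1983Higgs3, (1.21) p.416] -/
theorem iteratedDerivWithin_tiltExpect_zero_eq_sum_coefX {msq mu0sq lam : ℝ} (hm : 0 < msq) (hmu : 0 < mu0sq)
    (hlam : 0 < lam) (C : HiggsLattice.ChargeData N) (dm2 : ℝ) (nbar : ℕ) {F : Cfg P k N → ℝ} (hF : Continuous F)
    {K₀ : ℝ} {n₀ : ℕ} (hb : ∀ Φ, |F Φ| ≤ K₀ * (quartic P k Φ.2 + 1) ^ n₀) (n : ℕ) :
    iteratedDerivWithin n (tiltExpect (freeMeasure P k N (chargeZero C) msq mu0sq) F (totalVertex C lam dm2)) (Set.Ici 0) 0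
      = ∑ z : Fin n → VType nbar, coefX C lam msq mu0sq dm2 F nbar z := by
  haveI := freeMeasure_neZero (P := P) (k := k) (N := N) (chargeZero C) msq hmu
  rw [iteratedDerivWithin_tiltExpect_zero_eq_sum (tiltData_free_totalVertex hm hmu hlam C dm2 hF hb)
    (tiltData_free_totalVertex_one hm hmu hlam C dm2) (fun Φ => (neg_totalVertex_eq_sum_vtx C lam dm2 nbar Φ).symm)
    (integrable_colourProduct hm hmu C lam dm2 nbar hF hb), tiltZ_zero]
  rfl

/-- **GENUINE COLOURINGS CARRY THEIR TOTAL CHARGE ORDER**: if every vertex of `z` has a genuine type,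
`X_z(e) = e^{Σ_j ord z_j} · U_z`, `U_z = X_z(1)` charge-free. [cite: Balaban1983Higgs3, (1.21) p.416] -/
theorem coefX_eq_pow_mul (C : HiggsLattice.ChargeData N) (lam msq mu0sq dm2 : ℝ) (F : Cfg P k N → ℝ) (nbar : ℕ)
    {n : ℕ} {z : Fin n → VType nbar} (hz : ∀ j, Genuine nbar (z j)) :
    coefX C lam msq mu0sq dm2 F nbar z
      = C.e ^ (∑ j, ord nbar (z j)) * coefX (chargeOne C) lam msq mu0sq dm2 F nbar z := by
  unfold coefX
  rw [ursellOf_colourMoment_smul (fun c => C.e ^ ord nbar c) _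
    (fun j Φ => vtx_eq_pow_mul_chargeOne C lam dm2 nbar (hz j) Φ), prod_pow_eq_pow_sum]
  rfl

/-- **COLOURINGS WITH AN R-VERTEX ARE `O(e^{n̄+1})`**: if some vertex of `z` has the R-colour and `|e| ≤ 1`,
`|X_z(e)| ≤ |e|^{n̄+1} · R_z` with `R_z` charge-free. [cite: Balaban1983Higgs3, (1.21) p.416] -/
theorem abs_coefX_le {msq mu0sq lam : ℝ} (hm : 0 < msq) (hmu : 0 < mu0sq) (hlam : 0 < lam)
    (C : HiggsLattice.ChargeData N) (dm2 : ℝ) (nbar : ℕ) {F : Cfg P k N → ℝ} (hF : Continuous F) {K₀ : ℝ} {n₀ : ℕ}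
    (hb : ∀ Φ, |F Φ| ≤ K₀ * (quartic P k Φ.2 + 1) ^ n₀) (he : |C.e| ≤ 1) {n : ℕ} {z : Fin n → VType nbar}
    {j₀ : Fin n} (hj₀ : ¬ Genuine nbar (z j₀)) :
    |coefX C lam msq mu0sq dm2 F nbar z| ≤ |C.e| ^ (nbar + 1) * coefR C lam msq mu0sq dm2 F nbar z := by
  haveI := freeMeasure_neZero (P := P) (k := k) (N := N) (chargeZero C) msq hmu
  have hZ : 0 < (freeMeasure P k N (chargeZero C) msq mu0sq).real Set.univ := by
    rw [← tiltZ_zero _ (totalVertex C lam dm2)]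
    exact (tiltData_free_totalVertex_one hm hmu hlam C dm2).tiltZ_pos le_rfl
  exact abs_ursellOf_colourMoment_le hZ rfl (pow_nonneg (abs_nonneg _) _)
    (fun c Φ => abs_vtx_le_xhat C lam dm2 nbar he c Φ) (Genuine nbar)
    (fun c hc Φ => abs_vtx_le_pow_mul_xhat C lam dm2 nbar hc Φ)
    (fun K => integrable_hatProduct hm hmu C (chargeOne C) lam dm2 nbar hF hb K z) hj₀

/-! ### The model: (1.19) -/

section Model

variable {D : ModelData}

/-- **THE CHARGE ORDERS OF THE PERTURBATIVE COEFFICIENTS OF (1.19)**: for every charge-truncation order `n̄` and every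
`n`, the `n`-th total-vertex coefficient of `G^ε_{ab}(x,x′)` (FILE 1's `totalFamily`, derivatives at `t = 0⁺`) splits as
`Σ_{z genuine} e^{Σ_j ord z_j} U_z(δm²) + Σ_{z with an R-vertex} X_z(e)`, the `U_z` being truncated `ν⁰`-expectations of
`φ_a(x)φ_b(x′)` and `n` unit-charge vertices of print's types (1.6), (1.7), (1.8)_{j,0}, (1.10)_{j,0} (`j ≤ n̄`) — i.e. the
coefficient is a polynomial in `e` of degree `≤ n·n̄` with charge-free coefficients, up to the R-terms (`δm²` is held at its
value; print expands it further, (1.23)). [cite: Balaban1983Higgs3, (1.21)–(1.23) pp.416–417] -/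
theorem iteratedDerivWithin_totalFamily_zero_eq (hm : 0 < D.msq) (hmu : 0 < D.mu0sq) (hlam : 0 < D.lam)
    (a b : Fin D.N) (x x' : HiggsLattice.Site P 0) (nbar n : ℕ) :
    iteratedDerivWithin n (totalFamily D P a b x x') (Set.Ici 0) 0
      = ∑ z ∈ univ.filter (fun z : Fin n → VType nbar => ∀ j, Genuine nbar (z j)),
          D.C.e ^ (∑ j, ord nbar (z j))
            * coefX (chargeOne D.C) D.lam D.msq D.mu0sq (D.δmsq P.ε D.C.e D.lam) (fun Φ => Φ.2 x a * Φ.2 x' b) nbar z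
        + ∑ z ∈ univ.filter (fun z : Fin n → VType nbar => ¬ ∀ j, Genuine nbar (z j)),
          coefX D.C D.lam D.msq D.mu0sq (D.δmsq P.ε D.C.e D.lam) (fun Φ => Φ.2 x a * Φ.2 x' b) nbar z := by
  unfold totalFamily
  rw [iteratedDerivWithin_tiltExpect_zero_eq_sum_coefX hm hmu hlam D.C _ nbar (continuous_twoPointObs a b x x')
    (abs_twoPointObs_le a b x x') n,
    ← sum_filter_add_sum_filter_not univ (fun z : Fin n → VType nbar => ∀ j, Genuine nbar (z j))]
  congr 1
  exact sum_congr rfl fun z hz => coefX_eq_pow_mul D.C _ _ _ _ _ nbar (mem_filter.1 hz).2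

/-- **The R-terms are `O(e^{n̄+1})` uniformly in `|e| ≤ 1`**: every colouring with an R-vertex contributes at most
`|e|^{n̄+1}·R_z`, `R_z ≥ 0` charge-free (`coefR_eq`). [cite: Balaban1983Higgs3, (1.21) p.416] -/
theorem abs_coefX_model_le (hm : 0 < D.msq) (hmu : 0 < D.mu0sq) (hlam : 0 < D.lam) (he : |D.C.e| ≤ 1)
    (a b : Fin D.N) (x x' : HiggsLattice.Site P 0) (nbar : ℕ) {n : ℕ} {z : Fin n → VType nbar}
    (hz : ¬ ∀ j, Genuine nbar (z j)) :
    |coefX D.C D.lam D.msq D.mu0sq (D.δmsq P.ε D.C.e D.lam) (fun Φ => Φ.2 x a * Φ.2 x' b) nbar z|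
      ≤ |D.C.e| ^ (nbar + 1) * coefR D.C D.lam D.msq D.mu0sq (D.δmsq P.ε D.C.e D.lam) (fun Φ => Φ.2 x a * Φ.2 x' b) nbar z := by
  obtain ⟨j₀, hj₀⟩ := not_forall.1 hz
  exact abs_coefX_le hm hmu hlam D.C _ nbar (continuous_twoPointObs a b x x') (abs_twoPointObs_le a b x x') he hj₀

/-- **«THE FUNCTION `G^ε` HAS A PERTURBATIVE EXPANSION» (p. 416) WITH ITS CHARGE ORDERS**: for every `n̄`, `n` there is
`ξ ∈ (0,1)` with
`G^ε_{ab}(x,x′) = Σ_{k≤n} (1/k!) [Σ_{z ∈ (genuine types)^k} e^{Σ ord z_j} U_z + Σ_{z with an R-vertex} X_z] + (1/(n+1)!) (d/dt)^{n+1}G^ε_t|_{t=ξ}`,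
the `U_z` charge-free truncated `ν⁰`-expectations of the observable and `k` unit-charge vertices (1.6), (1.7), (1.8)_{j,0},
(1.10)_{j,0}, `j ≤ n̄` (graphs with propagators `C^ε_0`, `C^ε` by BRICK 5 at the Gaussian level), and each `X_z` bounded by
`|e|^{n̄+1}R_z` for `|e| ≤ 1` (`abs_coefX_model_le`). [cite: Balaban1983Higgs3, (1.21) p.416] -/
theorem twoPoint_charge_order_expansion (hm : 0 < D.msq) (hmu : 0 < D.mu0sq) (hlam : 0 < D.lam) (a b : Fin D.N)
    (x x' : HiggsLattice.Site P 0) (nbar n : ℕ) :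
    ∃ ξ ∈ Set.Ioo (0 : ℝ) 1, twoPoint D P a b x x'
      = ∑ k ∈ Finset.range (n + 1),
          (∑ z ∈ univ.filter (fun z : Fin k → VType nbar => ∀ j, Genuine nbar (z j)),
              D.C.e ^ (∑ j, ord nbar (z j))
                * coefX (chargeOne D.C) D.lam D.msq D.mu0sq (D.δmsq P.ε D.C.e D.lam) (fun Φ => Φ.2 x a * Φ.2 x' b) nbar z
            + ∑ z ∈ univ.filter (fun z : Fin k → VType nbar => ¬ ∀ j, Genuine nbar (z j)),
              coefX D.C D.lam D.msq D.mu0sq (D.δmsq P.ε D.C.e D.lam) (fun Φ => Φ.2 x a * Φ.2 x' b) nbar z)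
            / (k.factorial : ℝ)
        + iteratedDerivWithin (n + 1) (totalFamily D P a b x x') (Set.Ici 0) ξ / ((n + 1).factorial : ℝ) := by
  obtain ⟨ξ, hξ, h⟩ := twoPoint_totalVertex_expansion hm hmu hlam a b x x' n
  refine ⟨ξ, hξ, ?_⟩
  rw [h]
  congr 1
  exact sum_congr rfl fun k _ => by rw [iteratedDerivWithin_totalFamily_zero_eq hm hmu hlam a b x x' nbar k]

end Model

end Application

end Literature.MathematicalPhysics.QuantumFieldTheory.Balaban1983to89.B3Eq119ChargeOrders
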